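import Summits.AtomisticToContinuum.BoseEinsteinCondensation.Theses.BECPeriodicReduction
import Summits.AtomisticToContinuum.BoseEinsteinCondensation.Theses.BECSectorPoincareTwoScale
import Summits.AtomisticToContinuum.BoseEinsteinCondensation.Theses.BECWallDressingTransfer
import Summits.AtomisticToContinuum.BoseEinsteinCondensation.Theorems.BECThomsonPrinciplePeriodicToDirichletTorusFloorFromA
import Literature.MathematicalPhysics.QuantumManyBody.GroundState
import Literature.MathematicalPhysics.QuantumManyBody.SwapPurity
import Literature.MathematicalPhysics.QuantumManyBody.DyadicCoherentFractionRefinement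
import Literature.MathematicalPhysics.QuantumManyBody.PeriodicBoseGasFracEnergy
import Literature.MathematicalPhysics.QuantumManyBody.BoseGasCutoffStateOccupation
import Literature.MathematicalPhysics.QuantumManyBody.PeriodicBoseGasImpurityTranslation
import Summits.AtomisticToContinuum.BoseEinsteinCondensation.Theorems.BECInsertionVarianceGroundStateAccessibleExistence
import Summits.AtomisticToContinuum.BoseEinsteinCondensation.Theses.BECInsertionCorrector

/-!
# Line `coupled_baths_certified` for crux `BoundaryTransferWeak` (stmt-AtomisticToContinuum-0827)
# — the coupled-bath transfer with everything but three stubs PROVED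

Typed decomposition (crux-strategist, BC2 redirect) of the shared per-potential transfer crux
`BoundaryTransferWeak` (`A(v) → B'(v)`: torus BEC of the periodic near-minimisers at all small
densities ⟹ Dirichlet ground-state BEC at all small densities) into four pieces, with the
assembly PROVED here:

* `TorusInterfaceExists` (support, existence): eventually in `N = m+1`, the torus of side `L_N(ρ)`
  (the SAME cell as the box) carries a ground-state interface `Φ` (continuous, periodic, rigidly
  translation invariant, `≥ 0`, cell-normalised, `L²(cell)`-limit up to phase of all periodic
  near-minimisers). The Dirichlet ground state needs no item: it exists whenever `E₀^D < ⊤`, eventually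
  at low density (`BECInsertionVariance.eventually_groundStateEnergy_ne_top`, landed).
* `CoupledRelocationBound` (crux, the research piece; idea card `coupled-bath-relocation`): a
  COUPLING `π` of the Dirichlet law `Ψ₀² dX` and the torus law `Φ² dX|_cell` under which, with
  probability `≥ 1 - η`, the two slices `x ↦ Ψ₀(x :: X̂)`, `x ↦ Φ(x :: Ŷ)` — each at ITS OWN bath —
  are multiplicatively comparable on the inner cube `C = (L/4, 3L/4)³` off an exceptional set of
  relative volume and slice mass `≤ ε`: `ψ(x) φ(y) ≤ e^M ψ(y) φ(x)`, `M` uniform in `N`.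
* `BECWallDressingTransfer.GroundStateRigidity` (stmt-9072, shared crux, verbatim).
* `InnerFlatGroundStateToBEC` (support, provable now: `stub_condensedFromGroundState` + the
  near-minimiser transfer pattern + `le_condensateNumber`): rigidity at `v` and macroscopic
  inner-cube flat occupation of the Dirichlet ground state give `HasGroundStateBEC v ρ`.

Assembly `boundaryTransferWeak_of_coupledBaths`: the hypothesis `A` is consumed (through the landed
`TorusInTheBox.stub_torusFloorFromA`) to floor the inner-cube flat occupation of the interface `Φ`;
a reverse-Markov disintegration turns that floor into a torus TYPICALITY event of probability
`≥ c/32` (slice Bhattacharyya flatness `(∫_C φ)² ≥ (c/32)|C| ∫_C φ²`); the coupling moves the event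
to Dirichlet-typical baths; the in-measure multiplicative transfer (Tonelli on `(C∖S)³`) makes the
Dirichlet slices flat there; the disintegration of the inner flat-mode occupation of `Ψ₀` closes.
No energy is compared across boundary conditions and no state is transferred.
-/

noncomputable section

open MeasureTheory Filter
open scoped ENNReal NNReal ComplexConjugate

namespace Summit.AtomisticToContinuum.BoseEinsteinCondensation.Cruxes.BoundaryTransferWeak.CoupledBathsCertified

open Literature.MathematicalPhysics.QuantumManyBody.BoseGas
open Summit.AtomisticToContinuum.BoseEinsteinCondensation.Theses

/-! ## Vocabulary -/

/-- The inner cube `C = [L/4, 3L/4)³` of the box / cell of side `L` (the translate by `(L/4,L/4,L/4)`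
of the cell of side `L/2`; written exactly as the sub-cube of `TorusInTheBox.stub_torusFloorFromA`). -/
def innerCube (L : ℝ) : Set Space :=
  {x : Space | ∀ t, x t - L / 4 ∈ Set.Ico 0 (L / 2)}

/-- The inner cube is a translated cell of side `L/2`. -/
theorem innerCube_eq_cellShift (L : ℝ) :
    innerCube L = cellShift (L / 2) (WithLp.toLp 2 fun _ : Fin 3 => L / 4) := by
  ext x
  simp only [innerCube, cellShift, cell, Set.mem_setOf_eq, PiLp.sub_apply]

/-- The inner cube is measurable. -/
theorem measurableSet_innerCube (L : ℝ) : MeasurableSet (innerCube L) := by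
  rw [innerCube_eq_cellShift]
  exact measurableSet_cellShift _ _

/-- `|C| = (L/2)³`. -/
theorem volume_innerCube (L : ℝ) : volume (innerCube L) = ENNReal.ofReal (L / 2) ^ 3 := by
  rw [innerCube_eq_cellShift, volume_cellShift]

/-- The inner cube lies in the cell (for `L < 0` both are empty). -/
theorem innerCube_subset_cell (L : ℝ) : innerCube L ⊆ cell L := by
  intro x hx k
  obtain ⟨h1, h2⟩ := hx k
  rw [Set.mem_Ico]
  constructor <;> linarith

/-- The normalised flat mode of the inner cube (side `L/2`). -/
def innerMode (L : ℝ) : Space → ℂ :=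
  (innerCube L).indicator fun _ => ((Real.sqrt ((L / 2) ^ 3))⁻¹ : ℂ)

/-- Slice sum `∫_C F(x :: Y) dx` of a real `(m+1)`-body function at the bath `Y`. -/
def sliceSum {m : ℕ} (C : Set Space) (F : Config (m + 1) → ℝ) (Y : Config m) : ℝ≥0∞ :=
  ∫⁻ x in C, ENNReal.ofReal (F (Matrix.vecCons x Y))

/-- Slice square mass `∫_C F(x :: Y)² dx` of a real `(m+1)`-body function at the bath `Y`. -/
def sliceSq {m : ℕ} (C : Set Space) (F : Config (m + 1) → ℝ) (Y : Config m) : ℝ≥0∞ :=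
  ∫⁻ x in C, ENNReal.ofReal (F (Matrix.vecCons x Y) ^ 2)

/-- The torus ground-state INTERFACE on the cell of side `ℓ` (verbatim the hypothesis shape of
`TorusInTheBox.stub_torusFloorFromA`; inhabited for bounded `v` by `stub_torusInterfaceBounded`). -/
def IsTorusInterface (v : ℝ → ℝ≥0∞) (m : ℕ) (ℓ : ℝ) (Φ : Config (m + 1) → ℝ) : Prop :=
  Continuous Φ ∧
    (∀ (X : Config (m + 1)) (i : Fin (m + 1)) (k : Fin 3),
      Φ (X + Pi.single i (EuclideanSpace.single k ℓ)) = Φ X) ∧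
    (∀ (a : Space) (X : Config (m + 1)), Φ (fun i => X i + a) = Φ X) ∧
    (∀ X, 0 ≤ Φ X) ∧
    (∫⁻ X in cellN (m + 1) ℓ, (‖(Φ X : ℂ)‖₊ : ℝ≥0∞) ^ 2 = 1) ∧
    ∀ η : ℝ, 0 < η → ∃ δ : ℝ≥0∞, 0 < δ ∧ ∀ Ψ : PeriodicTrialState (m + 1) ℓ,
      periodicEnergy v Ψ ≤ periodicGroundStateEnergy v (m + 1) ℓ + δ →
        ∃ θ : ℝ, ∫ X in cellN (m + 1) ℓ,
          ‖Ψ.ψ X - Complex.exp (θ * Complex.I) * (Φ X : ℂ)‖ ^ 2 ≤ η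

/-- The torus law `Φ² dX` on the `(m+1)`-particle cell. -/
def torusLaw (m : ℕ) (ℓ : ℝ) (Φ : Config (m + 1) → ℝ) : Measure (Config (m + 1)) :=
  (volume.restrict (cellN (m + 1) ℓ)).withDensity fun X => ENNReal.ofReal (Φ X ^ 2)

/-- The Dirichlet law `Ψ₀² dX` of the canonical ground state `Ψ₀ = groundState v (m+1) L`. -/
def boxLaw (v : ℝ → ℝ≥0∞) (m : ℕ) (L : ℝ) : Measure (Config (m + 1)) :=
  volume.withDensity fun X => ENNReal.ofReal (groundState v (m + 1) L X ^ 2)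

/-- **The good event of a coupled pair** `p = (X̂-configuration of the box, Ŷ-configuration of the torus)`
at tolerance `ε` and cost bound `M`, for a box amplitude `F` and a torus amplitude `Φ` (real functions on
`(ℝ³)^{m+1}`): the tagged particles agree about membership of the inner cube `C`, and off an exceptional
measurable `S ⊆ C` of relative volume `≤ ε` carrying `≤ ε` of both slice masses the two slices are
multiplicatively comparable, `F(x::X̂_tail) Φ(y::Ŷ_tail) ≤ e^M F(y::X̂_tail) Φ(x::Ŷ_tail)` on `(C ∖ S)²`.
(No positivity / finiteness of the box slice is demanded: degenerate box slices form a `boxLaw`-null set.) -/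
def GoodPair {m : ℕ} (L : ℝ) (F Φ : Config (m + 1) → ℝ) (ε M : ℝ)
    (p : Config (m + 1) × Config (m + 1)) : Prop :=
  (p.1 0 ∈ innerCube L ↔ p.2 0 ∈ innerCube L) ∧
    ∃ S : Set Space, S ⊆ innerCube L ∧ MeasurableSet S ∧
      volume S ≤ ENNReal.ofReal ε * volume (innerCube L) ∧
      sliceSq S F (Fin.tail p.1) ≤ ENNReal.ofReal ε * sliceSq (innerCube L) F (Fin.tail p.1) ∧
      sliceSq S Φ (Fin.tail p.2) ≤ ENNReal.ofReal ε * sliceSq (innerCube L) Φ (Fin.tail p.2) ∧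
      ∀ x ∈ innerCube L \ S, ∀ y ∈ innerCube L \ S,
        F (Matrix.vecCons x (Fin.tail p.1)) * Φ (Matrix.vecCons y (Fin.tail p.2)) ≤
          Real.exp M * (F (Matrix.vecCons y (Fin.tail p.1)) * Φ (Matrix.vecCons x (Fin.tail p.2)))

/-! ## The four pieces -/

/-- **Piece 1 (support, existence of the torus interface).** For every admissible `v`, below some
density, eventually in `N = m+1`, the torus of side `L_N(ρ)` carries a ground-state interface. (Bounded
`v`: `TorusInTheBox.stub_torusInterfaceBounded`, at every density; hard cores: open — Feynman–Kac /
form methods for `v = ⊤·1_{[0,a]}`.) The Dirichlet side needs no item: the nonnegative Dirichlet ground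
state exists whenever `E₀ < ⊤`, eventually at low density
(`BECInsertionVariance.eventually_groundStateEnergy_ne_top`, landed). -/
def TorusInterfaceExists : Prop :=
  ∀ v : ℝ → ℝ≥0∞, IsRepulsiveFiniteRange v → ∃ ρT : ℝ, 0 < ρT ∧ ∀ ρ : ℝ, 0 < ρ → ρ < ρT →
    ∀ᶠ m : ℕ in atTop, ∃ Φ : Config (m + 1) → ℝ, IsTorusInterface v m (sideLength ρ (m + 1)) Φ

/-- **Piece 2 (crux): the coupled relocation bound.** For every admissible `v`, below some density,
for all `ε, η > 0` there is `M` (uniform in `N`) such that eventually in `N = m+1`, whenever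
`E₀^D(N, L) < ⊤` (so that the canonical nonnegative Dirichlet ground state `Ψ₀ = groundState v N L` of
the box of side `L = L_N(ρ)` exists), for every torus interface `Φ` on the cell
of side `L`, some coupling `π` of the laws `Ψ₀² dX` and `Φ² dX|_cell` gives probability `≥ 1 - η` to
a measurable set of pairs `(X̂, Ŷ)` on which: the tagged particles agree about membership of the inner
cube `C`; and off an exceptional `S ⊆ C` of relative volume `≤ ε` carrying `≤ ε` of both slice masses,
`Ψ₀(x::X̂_tail) Φ(y::Ŷ_tail) ≤ e^M Ψ₀(y::X̂_tail) Φ(x::Ŷ_tail)` for all `x, y ∈ C ∖ S`. -/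
def CoupledRelocationBound : Prop :=
  ∀ v : ℝ → ℝ≥0∞, IsRepulsiveFiniteRange v → ∃ ρC : ℝ, 0 < ρC ∧ ∀ ρ : ℝ, 0 < ρ → ρ < ρC →
    ∀ ε : ℝ, 0 < ε → ∀ η : ℝ, 0 < η → ∃ M : ℝ, ∀ᶠ m : ℕ in atTop,
      groundStateEnergy v (m + 1) (sideLength ρ (m + 1)) ≠ ⊤ →
        ∀ Φ : Config (m + 1) → ℝ, IsTorusInterface v m (sideLength ρ (m + 1)) Φ →
          ∃ π : Measure (Config (m + 1) × Config (m + 1)),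
            π.map Prod.fst = boxLaw v m (sideLength ρ (m + 1)) ∧
            π.map Prod.snd = torusLaw m (sideLength ρ (m + 1)) Φ ∧
            ∃ G : Set (Config (m + 1) × Config (m + 1)), MeasurableSet G ∧
              ENNReal.ofReal (1 - η) ≤ π G ∧
              ∀ p ∈ G, GoodPair (sideLength ρ (m + 1))
                (groundState v (m + 1) (sideLength ρ (m + 1))) Φ ε M p

/-- **Piece 2′ (crux, near-minimiser typing): the coupled relocation bound for torus near-minimisers.**
The same coupling statement with the torus amplitude `|Ψ|` of a periodic `δ`-near-minimiser `Ψ` (the slack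
`δ > 0` chosen by the statement, after `N`) in place of a ground-state interface — no torus ground-state
object is needed, so hard cores are covered without an existence input (the live lead's typing of the idea,
line `Sketch`). -/
def CoupledRelocationBoundNearMin : Prop :=
  ∀ v : ℝ → ℝ≥0∞, IsRepulsiveFiniteRange v → ∃ ρC : ℝ, 0 < ρC ∧ ∀ ρ : ℝ, 0 < ρ → ρ < ρC →
    ∀ ε : ℝ, 0 < ε → ∀ η : ℝ, 0 < η → ∃ M : ℝ, ∀ᶠ m : ℕ in atTop,
      groundStateEnergy v (m + 1) (sideLength ρ (m + 1)) ≠ ⊤ →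
        ∃ δ : ℝ≥0∞, 0 < δ ∧ ∀ Ψ : PeriodicTrialState (m + 1) (sideLength ρ (m + 1)),
          periodicEnergy v Ψ ≤ periodicGroundStateEnergy v (m + 1) (sideLength ρ (m + 1)) + δ →
            ∃ π : Measure (Config (m + 1) × Config (m + 1)),
              π.map Prod.fst = boxLaw v m (sideLength ρ (m + 1)) ∧
              π.map Prod.snd = torusLaw m (sideLength ρ (m + 1)) (fun X => ‖Ψ.ψ X‖) ∧
              ∃ G : Set (Config (m + 1) × Config (m + 1)), MeasurableSet G ∧
                ENNReal.ofReal (1 - η) ≤ π G ∧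
                ∀ p ∈ G, GoodPair (sideLength ρ (m + 1))
                  (groundState v (m + 1) (sideLength ρ (m + 1))) (fun X => ‖Ψ.ψ X‖) ε M p

/-- **Piece 3 (support, box closing).** For every admissible `v`: `L²`-rigidity of the Dirichlet
near-minimisers at `v` (the body of stmt-9072 at `v`) and, eventually in `N = m+1`, finiteness of `E₀^D`
plus a macroscopic inner-cube flat-mode occupation of the nonnegative ground state, give
`HasGroundStateBEC v ρ`. (Provable now: the pattern of `TorusInTheBox.stub_condensedFromGroundState` with
`BECInsertionVariance.isGroundState_groundState_of_ne_top` in place of uniqueness, the Lipschitz transfer of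
`stub_nearMinimiserTransfer`, `occupation_le_maxOccupation`, `le_condensateNumber`.) -/
def InnerFlatGroundStateToBEC : Prop :=
  ∀ v : ℝ → ℝ≥0∞, IsRepulsiveFiniteRange v →
    (∃ ρ₀ : ℝ, 0 < ρ₀ ∧ ∀ ρ : ℝ, 0 < ρ → ρ < ρ₀ → ∀ᶠ N : ℕ in atTop, ∀ η : ℝ, 0 < η →
      ∃ δ : ℝ≥0∞, 0 < δ ∧ ∀ Ψ Φ : TrialState N (sideLength ρ N),
        energy v Ψ ≤ groundStateEnergy v N (sideLength ρ N) + δ →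
          energy v Φ ≤ groundStateEnergy v N (sideLength ρ N) + δ →
            ∃ c : ℂ, ‖c‖ = 1 ∧ ∫⁻ X, (‖Ψ.ψ X - c * Φ.ψ X‖₊ : ℝ≥0∞) ^ 2 ≤ ENNReal.ofReal η) →
    ∃ ρB : ℝ, 0 < ρB ∧ ∀ ρ : ℝ, 0 < ρ → ρ < ρB → ∀ c : ℝ, 0 < c →
      (∀ᶠ m : ℕ in atTop,
        groundStateEnergy v (m + 1) (sideLength ρ (m + 1)) ≠ ⊤ ∧
          ENNReal.ofReal (c * (m + 1 : ℕ)) ≤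
            occupation (m + 1) (innerMode (sideLength ρ (m + 1)))
              (fun X => (groundState v (m + 1) (sideLength ρ (m + 1)) X : ℂ))) →
      HasGroundStateBEC v ρ

/-! ## Core lemmas of the assembly -/

section Core

variable {m : ℕ}

/-- Cauchy–Schwarz on a set: `(∫_A u)² ≤ |A| ∫_A u²` for `u ≥ 0`. -/
theorem setLIntegral_ofReal_sq_le' (A : Set Space) {u : Space → ℝ} (hu : Measurable u)
    (hu0 : ∀ x, 0 ≤ u x) :
    (∫⁻ x in A, ENNReal.ofReal (u x)) ^ 2 ≤ volume A * ∫⁻ x in A, ENNReal.ofReal (u x ^ 2) := by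
  have h := lintegral_mul_sq_le (volume.restrict A) (f := fun x => ENNReal.ofReal (u x))
    (g := fun _ => (1 : ℝ≥0∞)) (by fun_prop) (by fun_prop)
  simp only [mul_one, one_pow, lintegral_const, Measure.restrict_apply_univ, one_mul] at h
  calc (∫⁻ x in A, ENNReal.ofReal (u x)) ^ 2
      ≤ (∫⁻ x in A, ENNReal.ofReal (u x) ^ 2) * volume A := h
    _ = volume A * ∫⁻ x in A, ENNReal.ofReal (u x ^ 2) := by
        rw [mul_comm]
        congr 1
        refine lintegral_congr fun x => ?_
        rw [ENNReal.ofReal_pow (hu0 x)]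

/-- `Fin.tail` of a prepended configuration. -/
@[simp] theorem tail_vecCons (x : Space) (Y : Config m) : Fin.tail (Matrix.vecCons x Y) = Y :=
  Fin.tail_cons _ _

/-- `‖(√v)⁻¹‖²  = v⁻¹` in `ℝ≥0∞` for `v > 0` (complex constant). -/
theorem ennnorm_inv_sqrt_sq' {v : ℝ} (hv : 0 < v) :
    ((‖((Real.sqrt v : ℝ) : ℂ)⁻¹‖₊ : ℝ≥0∞)) ^ 2 = ENNReal.ofReal v⁻¹ := by
  rw [coe_nnnorm_sq_eq_ofReal, norm_inv, Complex.norm_real,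
    Real.norm_of_nonneg (Real.sqrt_nonneg _), inv_pow, Real.sq_sqrt hv.le]

/-- Slices of a measurable real function are measurable. -/
theorem measurable_slice {F : Config (m + 1) → ℝ} (hF : Measurable F) (Y : Config m) :
    Measurable fun x : Space => F (Matrix.vecCons x Y) :=
  hF.comp (measurable_vecCons.comp (measurable_id.prodMk measurable_const))

/-- `Y ↦ sliceSum C F Y` is measurable. -/
theorem measurable_sliceSum {C : Set Space} (hC : MeasurableSet C) {F : Config (m + 1) → ℝ}
    (hF : Measurable F) : Measurable fun Y : Config m => sliceSum C F Y := by
  unfold sliceSum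
  have h : Measurable fun p : Config m × Space => ENNReal.ofReal (F (Matrix.vecCons p.2 p.1)) :=
    ENNReal.measurable_ofReal.comp (hF.comp (measurable_vecCons_snd_fst m))
  simp_rw [← lintegral_indicator hC]
  exact (Measurable.lintegral_prod_right (f := fun Y x =>
    C.indicator (fun x => ENNReal.ofReal (F (Matrix.vecCons x Y))) x)
    (by
      have : (Function.uncurry fun Y x =>
          C.indicator (fun x => ENNReal.ofReal (F (Matrix.vecCons x Y))) x) =
          fun p : Config m × Space => (Set.univ ×ˢ C).indicator
            (fun p => ENNReal.ofReal (F (Matrix.vecCons p.2 p.1))) p := by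
        funext p
        by_cases hp : p.2 ∈ C <;> simp [Function.uncurry, Set.indicator, hp]
      rw [this]
      exact h.indicator (MeasurableSet.univ.prod hC)))

/-- `Y ↦ sliceSq C F Y` is measurable. -/
theorem measurable_sliceSq {C : Set Space} (hC : MeasurableSet C) {F : Config (m + 1) → ℝ}
    (hF : Measurable F) : Measurable fun Y : Config m => sliceSq C F Y := by
  have h := measurable_sliceSum (m := m) hC (F := fun X => F X ^ 2) (hF.pow_const 2)
  exact h

/-- Cauchy–Schwarz for slices: `(∫_C F)² ≤ |C| ∫_C F²`. -/
theorem sliceSum_sq_le {C : Set Space} {F : Config (m + 1) → ℝ} (hF : Measurable F)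
    (hF0 : ∀ X, 0 ≤ F X) (Y : Config m) :
    sliceSum C F Y ^ 2 ≤ volume C * sliceSq C F Y :=
  setLIntegral_ofReal_sq_le' C (measurable_slice hF Y) fun _ => hF0 _

/-- The flatness ratio times the slice mass is at most `|C|⁻¹ |∫_C F|²` (with equality off the
degenerate slices). -/
theorem flatness_mul_sliceSq_le {C : Set Space} (_hC : MeasurableSet C) (hC0 : volume C ≠ 0)
    (hCtop : volume C ≠ ⊤) {F : Config (m + 1) → ℝ} (hF : Measurable F) (hF0 : ∀ X, 0 ≤ F X)
    (Y : Config m) :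
    sliceSum C F Y ^ 2 / (volume C * sliceSq C F Y) * sliceSq C F Y ≤
      ((‖((Real.sqrt (volume C).toReal : ℝ) : ℂ)⁻¹‖₊ : ℝ≥0∞)) ^ 2 *
        (‖∫ x in C, (F (Matrix.vecCons x Y) : ℂ)‖₊ : ℝ≥0∞) ^ 2 := by
  set W := sliceSq C F Y with hW
  set S := sliceSum C F Y with hS
  rcases eq_or_ne W 0 with hW0 | hW0
  · simp [hW0]
  rcases eq_or_ne W ⊤ with hWt | hWt
  · rw [hWt, ENNReal.mul_top hC0, ENNReal.div_top, zero_mul]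
    exact zero_le
  -- `0 < W < ⊤`: the slice is integrable on `C`
  have hv0 : 0 < (volume C).toReal := ENNReal.toReal_pos hC0 hCtop
  have hS2 : S ^ 2 ≤ volume C * W := sliceSum_sq_le hF hF0 Y
  have hStop : S ≠ ⊤ := by
    intro h
    rw [h, ENNReal.top_pow two_ne_zero] at hS2
    exact ENNReal.mul_ne_top hCtop hWt (le_antisymm le_top hS2)
  have hint : IntegrableOn (fun x => F (Matrix.vecCons x Y)) C volume := by
    refine ⟨(measurable_slice hF Y).aestronglyMeasurable, ?_⟩
    rw [hasFiniteIntegral_iff_enorm]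
    have : ∫⁻ x in C, ‖F (Matrix.vecCons x Y)‖ₑ = S := by
      refine lintegral_congr fun x => ?_
      exact Real.enorm_eq_ofReal (hF0 _)
    rw [this]
    exact lt_top_iff_ne_top.2 hStop
  have hre : ∫ x in C, (F (Matrix.vecCons x Y) : ℂ) = ((∫ x in C, F (Matrix.vecCons x Y) : ℝ) : ℂ) :=
    integral_complex_ofReal
  have hr0 : 0 ≤ ∫ x in C, F (Matrix.vecCons x Y) := integral_nonneg fun x => hF0 _
  have hSr : S = ENNReal.ofReal (∫ x in C, F (Matrix.vecCons x Y)) := by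
    rw [hS, sliceSum, ofReal_integral_eq_lintegral_ofReal hint (Eventually.of_forall fun x => hF0 _)]
  have hnorm : (‖∫ x in C, (F (Matrix.vecCons x Y) : ℂ)‖₊ : ℝ≥0∞) ^ 2 = S ^ 2 := by
    rw [hre, coe_nnnorm_sq_eq_ofReal, Complex.norm_real, Real.norm_of_nonneg hr0, hSr,
      ENNReal.ofReal_pow hr0]
  rw [hnorm, ennnorm_inv_sqrt_sq' hv0, ENNReal.ofReal_inv_of_pos hv0, ENNReal.ofReal_toReal hCtop]
  -- algebra: `S²/(V W) · W = V⁻¹ S²`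
  have h1 : S ^ 2 / (volume C * W) * W = S ^ 2 / volume C := by
    rw [ENNReal.div_eq_inv_mul, ENNReal.div_eq_inv_mul,
      ENNReal.mul_inv (Or.inl hC0) (Or.inl hCtop)]
    calc (volume C)⁻¹ * W⁻¹ * S ^ 2 * W = (volume C)⁻¹ * S ^ 2 * (W⁻¹ * W) := by ring
      _ = (volume C)⁻¹ * S ^ 2 := by rw [ENNReal.inv_mul_cancel hW0 hWt, mul_one]
  rw [h1, ENNReal.div_eq_inv_mul]

/-- **Box disintegration.** The inner flat-mode occupation of a nonnegative measurable `F` dominates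
`(m+1) E_{F² dX}[1_C(x₀) · h(X̂)]` with the slice flatness `h = (∫_C F)²/(|C| ∫_C F²)`. -/
theorem occupation_indicator_ge_lintegral_flatness {F : Config (m + 1) → ℝ} (hF : Measurable F)
    (hF0 : ∀ X, 0 ≤ F X) {C : Set Space} (hC : MeasurableSet C) (hC0 : volume C ≠ 0)
    (hCtop : volume C ≠ ⊤) :
    (m + 1 : ℝ≥0∞) * ∫⁻ X, {X : Config (m + 1) | X 0 ∈ C}.indicator
        (fun X => sliceSum C F (Fin.tail X) ^ 2 / (volume C * sliceSq C F (Fin.tail X)) *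
          ENNReal.ofReal (F X ^ 2)) X ≤
      occupation (m + 1) (C.indicator fun _ => ((Real.sqrt (volume C).toReal)⁻¹ : ℂ))
        fun X => (F X : ℂ) := by
  rw [occupation_succ]
  gcongr
  -- measurability of the integrand
  set h : Config m → ℝ≥0∞ := fun Y => sliceSum C F Y ^ 2 / (volume C * sliceSq C F Y) with hh
  have hmh : Measurable h :=
    ((measurable_sliceSum hC hF).pow_const 2).div ((measurable_sliceSq hC hF).const_mul _)
  have htail : Measurable fun X : Config (m + 1) => Fin.tail X :=
    measurable_pi_lambda _ fun i => measurable_pi_apply _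
  have hT : MeasurableSet {X : Config (m + 1) | X 0 ∈ C} := measurable_pi_apply 0 hC
  have hG : Measurable fun X : Config (m + 1) => h (Fin.tail X) * ENNReal.ofReal (F X ^ 2) :=
    (hmh.comp htail).mul (ENNReal.measurable_ofReal.comp (hF.pow_const 2))
  rw [lintegral_config_succ (hG.indicator hT)]
  refine lintegral_mono fun Y => ?_
  -- the inner integral is `h Y * sliceSq C F Y`
  have hinner : ∫⁻ x, {X : Config (m + 1) | X 0 ∈ C}.indicator
      (fun X => h (Fin.tail X) * ENNReal.ofReal (F X ^ 2)) (Matrix.vecCons x Y) =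
      h Y * sliceSq C F Y := by
    have hpt : ∀ x, {X : Config (m + 1) | X 0 ∈ C}.indicator
        (fun X => h (Fin.tail X) * ENNReal.ofReal (F X ^ 2)) (Matrix.vecCons x Y) =
        C.indicator (fun x => h Y * ENNReal.ofReal (F (Matrix.vecCons x Y) ^ 2)) x := by
      intro x
      by_cases hx : x ∈ C
      · have : Matrix.vecCons x Y ∈ {X : Config (m + 1) | X 0 ∈ C} := by simpa using hx
        rw [Set.indicator_of_mem this, Set.indicator_of_mem hx, tail_vecCons]
      · have : Matrix.vecCons x Y ∉ {X : Config (m + 1) | X 0 ∈ C} := by simpa using hx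
        rw [Set.indicator_of_notMem this, Set.indicator_of_notMem hx]
    simp_rw [hpt]
    have hms : Measurable fun x => ENNReal.ofReal (F (Matrix.vecCons x Y) ^ 2) :=
      ENNReal.measurable_ofReal.comp ((measurable_slice hF Y).pow_const 2)
    rw [lintegral_indicator hC, lintegral_const_mul _ hms]
    rfl
  rw [hinner]
  -- the mode integral is `(√|C|)⁻¹ ∫_C F`
  have hmode : ∫ x, conj (C.indicator (fun _ => ((Real.sqrt (volume C).toReal : ℝ) : ℂ)⁻¹) x) *
      (F (Matrix.vecCons x Y) : ℂ) =
      ((Real.sqrt (volume C).toReal : ℝ) : ℂ)⁻¹ * ∫ x in C, (F (Matrix.vecCons x Y) : ℂ) := by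
    have hind : (fun x => conj (C.indicator (fun _ => ((Real.sqrt (volume C).toReal : ℝ) : ℂ)⁻¹) x) *
        (F (Matrix.vecCons x Y) : ℂ)) =
        C.indicator fun x => ((Real.sqrt (volume C).toReal : ℝ) : ℂ)⁻¹ *
          (F (Matrix.vecCons x Y) : ℂ) := by
      funext x
      by_cases hx : x ∈ C
      · simp [hx, Complex.conj_ofReal]
      · simp [hx]
    rw [hind, integral_indicator hC, integral_const_mul]
  have hk : (((Real.sqrt (volume C).toReal)⁻¹ : ℂ)) = ((Real.sqrt (volume C).toReal : ℝ) : ℂ)⁻¹ := by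
    ring
  rw [show (C.indicator fun _ => ((Real.sqrt (volume C).toReal)⁻¹ : ℂ)) =
      C.indicator fun _ => ((Real.sqrt (volume C).toReal : ℝ) : ℂ)⁻¹ by rw [hk], hmode,
    nnnorm_mul, ENNReal.coe_mul, mul_pow]
  exact flatness_mul_sliceSq_le hC hC0 hCtop hF hF0 Y

/-- Membership of a prepended configuration in the `(m+1)`-particle cell. -/
theorem vecCons_mem_cellN_iff {ℓ : ℝ} (x : Space) (Y : Config m) :
    Matrix.vecCons x Y ∈ cellN (m + 1) ℓ ↔ x ∈ cell ℓ ∧ Y ∈ cellN m ℓ := by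
  constructor
  · intro h
    refine ⟨by simpa using h 0, fun k => by simpa using h k.succ⟩
  · rintro ⟨hx, hY⟩ j
    refine Fin.cases ?_ (fun k => ?_) j
    · simpa using hx
    · simpa using hY k

/-- For an integrable nonnegative slice, `|∫_C F|² = (∫⁻_C F)²` in `ℝ≥0∞`. -/
theorem ennnorm_sq_setIntegral_eq_sliceSum_sq {C : Set Space} {F : Config (m + 1) → ℝ}
    (hF0 : ∀ X, 0 ≤ F X) (Y : Config m)
    (hint : IntegrableOn (fun x => F (Matrix.vecCons x Y)) C volume) :
    (‖∫ x in C, (F (Matrix.vecCons x Y) : ℂ)‖₊ : ℝ≥0∞) ^ 2 = sliceSum C F Y ^ 2 := by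
  have hre : ∫ x in C, (F (Matrix.vecCons x Y) : ℂ) =
      ((∫ x in C, F (Matrix.vecCons x Y) : ℝ) : ℂ) := integral_complex_ofReal
  have hr0 : 0 ≤ ∫ x in C, F (Matrix.vecCons x Y) := integral_nonneg fun x => hF0 _
  have hSr : sliceSum C F Y = ENNReal.ofReal (∫ x in C, F (Matrix.vecCons x Y)) := by
    rw [sliceSum, ofReal_integral_eq_lintegral_ofReal hint (Eventually.of_forall fun x => hF0 _)]
  rw [hre, coe_nnnorm_sq_eq_ofReal, Complex.norm_real, Real.norm_of_nonneg hr0, hSr,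
    ENNReal.ofReal_pow hr0]

/-- **The cell occupation of the flat mode of `C ⊆ cell` through slice sums**, for a continuous
nonnegative `Φ`: `(m+1) |C|⁻¹ ∫_{cellᵐ} (∫_C Φ(·,Y))² dY`. -/
theorem cellOccupation_indicator_eq {ℓ : ℝ} {Φ : Config (m + 1) → ℝ} (hΦc : Continuous Φ)
    (hΦ0 : ∀ X, 0 ≤ Φ X) {C : Set Space} (hC : MeasurableSet C) (hCcell : C ⊆ cell ℓ)
    (hC0 : volume C ≠ 0) (hCtop : volume C ≠ ⊤) :
    cellOccupation (m + 1) ℓ (C.indicator fun _ => ((Real.sqrt (volume C).toReal)⁻¹ : ℂ))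
        (fun X => (Φ X : ℂ)) =
      (m + 1 : ℝ≥0∞) * ∫⁻ Y in cellN m ℓ, (volume C)⁻¹ * sliceSum C Φ Y ^ 2 := by
  rw [cellOccupation_succ]
  congr 1
  refine lintegral_congr fun Y => ?_
  have hv0 : 0 < (volume C).toReal := ENNReal.toReal_pos hC0 hCtop
  have hind : (fun x => conj (C.indicator (fun _ => ((Real.sqrt (volume C).toReal)⁻¹ : ℂ)) x) *
      (Φ (Matrix.vecCons x Y) : ℂ)) =
      C.indicator fun x => ((Real.sqrt (volume C).toReal : ℝ) : ℂ)⁻¹ *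
        (Φ (Matrix.vecCons x Y) : ℂ) := by
    funext x
    by_cases hx : x ∈ C
    · simp [hx, Complex.conj_ofReal]
    · simp [hx]
  have hint : IntegrableOn (fun x => Φ (Matrix.vecCons x Y)) C volume :=
    (integrableOn_cell (L := ℓ) (hΦc.comp (continuous_id.matrixVecCons continuous_const))).mono_set
      hCcell
  rw [hind, integral_indicator hC, Measure.restrict_restrict hC, Set.inter_eq_left.mpr hCcell,
    integral_const_mul, nnnorm_mul, ENNReal.coe_mul, mul_pow, ennnorm_inv_sqrt_sq' hv0,
    ENNReal.ofReal_inv_of_pos hv0, ENNReal.ofReal_toReal hCtop,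
    ennnorm_sq_setIntegral_eq_sliceSum_sq hΦ0 Y hint]

/-- Slice square masses over the cell integrate to at most the cell norm: for `C ⊆ cell`,
`∫_{cellᵐ} ∫_C Φ(x,Y)² ≤ ∫_{cell^{m+1}} Φ²`. -/
theorem lintegral_cellN_sliceSq_le {ℓ : ℝ} {Φ : Config (m + 1) → ℝ} (hΦ : Measurable Φ)
    {C : Set Space} (hC : MeasurableSet C) (hCcell : C ⊆ cell ℓ) :
    ∫⁻ Y in cellN m ℓ, sliceSq C Φ Y ≤ ∫⁻ X in cellN (m + 1) ℓ, ENNReal.ofReal (Φ X ^ 2) := by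
  have hmeas : Measurable fun X : Config (m + 1) => ENNReal.ofReal (Φ X ^ 2) :=
    ENNReal.measurable_ofReal.comp (hΦ.pow_const 2)
  have hR : ∫⁻ X in cellN (m + 1) ℓ, ENNReal.ofReal (Φ X ^ 2) =
      ∫⁻ Y, ∫⁻ x, (cellN (m + 1) ℓ).indicator (fun X => ENNReal.ofReal (Φ X ^ 2))
        (Matrix.vecCons x Y) := by
    rw [← lintegral_indicator (measurableSet_cellN _ _),
      lintegral_config_succ (hmeas.indicator (measurableSet_cellN _ _))]
  have hL : ∫⁻ Y in cellN m ℓ, sliceSq C Φ Y = ∫⁻ Y, (cellN m ℓ).indicator (sliceSq C Φ) Y :=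
    (lintegral_indicator (measurableSet_cellN _ _) _).symm
  rw [hL, hR]
  refine lintegral_mono fun Y => ?_
  by_cases hY : Y ∈ cellN m ℓ
  · rw [Set.indicator_of_mem hY, sliceSq, ← lintegral_indicator hC]
    refine lintegral_mono fun x => ?_
    by_cases hx : x ∈ C
    · rw [Set.indicator_of_mem hx, Set.indicator_of_mem ((vecCons_mem_cellN_iff x Y).2
        ⟨hCcell hx, hY⟩)]
    · rw [Set.indicator_of_notMem hx]
      exact zero_le
  · rw [Set.indicator_of_notMem hY]
    exact zero_le

/-- The torus law of a head-and-tail event: `P{X 0 ∈ C, tail X ∈ G} = ∫_{cellᵐ ∩ G} ∫_C Φ²`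
for `C ⊆ cell`. -/
theorem torusLaw_apply_head_tail {ℓ : ℝ} {Φ : Config (m + 1) → ℝ} (hΦ : Measurable Φ)
    {C : Set Space} (hC : MeasurableSet C) (hCcell : C ⊆ cell ℓ) {G : Set (Config m)}
    (hG : MeasurableSet G) :
    torusLaw m ℓ Φ {X | X 0 ∈ C ∧ Fin.tail X ∈ G} = ∫⁻ Y in cellN m ℓ, G.indicator (sliceSq C Φ) Y := by
  have htail : Measurable fun X : Config (m + 1) => Fin.tail X :=
    measurable_pi_lambda _ fun i => measurable_pi_apply _
  have hE : MeasurableSet {X : Config (m + 1) | X 0 ∈ C ∧ Fin.tail X ∈ G} :=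
    (measurable_pi_apply 0 hC).inter (htail hG)
  have hmeas : Measurable fun X : Config (m + 1) => ENNReal.ofReal (Φ X ^ 2) :=
    ENNReal.measurable_ofReal.comp (hΦ.pow_const 2)
  rw [torusLaw, withDensity_apply _ hE, Measure.restrict_restrict hE, ← lintegral_indicator
    (hE.inter (measurableSet_cellN _ _)), lintegral_config_succ (hmeas.indicator
    (hE.inter (measurableSet_cellN _ _))), ← lintegral_indicator (measurableSet_cellN _ _)]
  refine lintegral_congr fun Y => ?_
  by_cases hY : Y ∈ cellN m ℓ ∧ Y ∈ G
  · rw [Set.indicator_of_mem hY.1, Set.indicator_of_mem hY.2, sliceSq, ← lintegral_indicator hC]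
    refine lintegral_congr fun x => ?_
    by_cases hx : x ∈ C
    · have hmem : Matrix.vecCons x Y ∈
          {X : Config (m + 1) | X 0 ∈ C ∧ Fin.tail X ∈ G} ∩ cellN (m + 1) ℓ :=
        ⟨⟨by simpa using hx, by simpa using hY.2⟩, (vecCons_mem_cellN_iff x Y).2 ⟨hCcell hx, hY.1⟩⟩
      rw [Set.indicator_of_mem hmem, Set.indicator_of_mem hx]
    · have hnot : Matrix.vecCons x Y ∉
          {X : Config (m + 1) | X 0 ∈ C ∧ Fin.tail X ∈ G} ∩ cellN (m + 1) ℓ := by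
        intro h; exact hx (by simpa using h.1.1)
      rw [Set.indicator_of_notMem hnot, Set.indicator_of_notMem hx]
  · have hzero : ∀ x, ({X : Config (m + 1) | X 0 ∈ C ∧ Fin.tail X ∈ G} ∩ cellN (m + 1) ℓ).indicator
        (fun X => ENNReal.ofReal (Φ X ^ 2)) (Matrix.vecCons x Y) = 0 := by
      intro x
      refine Set.indicator_of_notMem (fun h => hY ?_) _
      exact ⟨((vecCons_mem_cellN_iff x Y).1 h.2).2, by simpa using h.1.2⟩
    simp_rw [hzero]
    rw [lintegral_zero]
    rcases not_and_or.1 hY with h | h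
    · rw [Set.indicator_of_notMem h]
    · by_cases hc : Y ∈ cellN m ℓ
      · rw [Set.indicator_of_mem hc, Set.indicator_of_notMem h]
      · rw [Set.indicator_of_notMem hc]

/-- **Torus typicality (reverse Markov).** From a floor on the inner-cube flat occupation of a
nonnegative cell-normalised continuous `Φ`, the torus law gives probability `≥ c₁ - κ` to the event
"the tagged particle is in `C` and the slice of its bath is Bhattacharyya-flat at level `κ` on `C`". -/
theorem torusLaw_flatEvent_ge {ℓ : ℝ} {Φ : Config (m + 1) → ℝ} (hΦc : Continuous Φ)
    (hΦ0 : ∀ X, 0 ≤ Φ X)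
    (hΦ1 : ∫⁻ X in cellN (m + 1) ℓ, ENNReal.ofReal (Φ X ^ 2) = 1)
    {C : Set Space} (hC : MeasurableSet C) (hCcell : C ⊆ cell ℓ) (hC0 : volume C ≠ 0)
    (hCtop : volume C ≠ ⊤) {c₁ κ : ℝ} (hκ : 0 < κ)
    (hfloor : ENNReal.ofReal (c₁ * (m + 1 : ℕ)) ≤
      cellOccupation (m + 1) ℓ (C.indicator fun _ => ((Real.sqrt (volume C).toReal)⁻¹ : ℂ))
        fun X => (Φ X : ℂ)) :
    ENNReal.ofReal (c₁ - κ) ≤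
      torusLaw m ℓ Φ {X | X 0 ∈ C ∧ Fin.tail X ∈ {Y : Config m |
        ENNReal.ofReal κ * volume C * sliceSq C Φ Y ≤ sliceSum C Φ Y ^ 2 ∧
        0 < sliceSq C Φ Y ∧ sliceSq C Φ Y < ⊤}} := by
  -- trivial when `c₁ ≤ κ`
  rcases le_or_gt c₁ κ with hle | hlt
  · rw [ENNReal.ofReal_of_nonpos (sub_nonpos.2 hle)]
    exact zero_le
  have hc₁ : 0 < c₁ := hκ.trans hlt
  have hΦm : Measurable Φ := hΦc.measurable
  set G : Set (Config m) := {Y | ENNReal.ofReal κ * volume C * sliceSq C Φ Y ≤ sliceSum C Φ Y ^ 2 ∧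
    0 < sliceSq C Φ Y ∧ sliceSq C Φ Y < ⊤} with hGdef
  have hmS := measurable_sliceSum (m := m) hC hΦm
  have hmW := measurable_sliceSq (m := m) hC hΦm
  have hG : MeasurableSet G := by
    refine (measurableSet_le (hmW.const_mul _) (hmS.pow_const 2)).inter
      ((measurableSet_lt measurable_const hmW).inter (measurableSet_lt hmW measurable_const))
  rw [torusLaw_apply_head_tail hΦm hC hCcell hG]
  -- the floor through slice sums
  rw [cellOccupation_indicator_eq hΦc hΦ0 hC hCcell hC0 hCtop, ENNReal.ofReal_mul hc₁.le,
    ENNReal.ofReal_natCast, mul_comm (ENNReal.ofReal c₁)] at hfloor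
  push_cast at hfloor
  have hfloor' : ENNReal.ofReal c₁ ≤ ∫⁻ Y in cellN m ℓ, (volume C)⁻¹ * sliceSum C Φ Y ^ 2 :=
    (ENNReal.mul_le_mul_iff_right (by simp) (by simp)).1 hfloor
  -- pointwise reverse Markov
  have hpt : ∀ Y, (volume C)⁻¹ * sliceSum C Φ Y ^ 2 ≤
      G.indicator (sliceSq C Φ) Y + ENNReal.ofReal κ * sliceSq C Φ Y := by
    intro Y
    have hCS : sliceSum C Φ Y ^ 2 ≤ volume C * sliceSq C Φ Y := sliceSum_sq_le hΦm hΦ0 Y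
    by_cases hY : Y ∈ G
    · rw [Set.indicator_of_mem hY]
      calc (volume C)⁻¹ * sliceSum C Φ Y ^ 2 ≤ (volume C)⁻¹ * (volume C * sliceSq C Φ Y) := by
            gcongr
        _ = sliceSq C Φ Y := by rw [← mul_assoc, ENNReal.inv_mul_cancel hC0 hCtop, one_mul]
        _ ≤ sliceSq C Φ Y + ENNReal.ofReal κ * sliceSq C Φ Y := le_self_add
    · rw [Set.indicator_of_notMem hY, zero_add]
      rcases eq_or_ne (sliceSq C Φ Y) 0 with h0 | h0
      · have : sliceSum C Φ Y ^ 2 = 0 := le_antisymm (by simpa [h0] using hCS) zero_le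
        simp [this, h0]
      rcases eq_or_ne (sliceSq C Φ Y) ⊤ with ht | ht
      · rw [ht, ENNReal.mul_top (by simpa using hκ)]
        exact le_top
      have hlt' : sliceSum C Φ Y ^ 2 < ENNReal.ofReal κ * volume C * sliceSq C Φ Y := by
        by_contra hge
        exact hY ⟨not_lt.1 hge, pos_iff_ne_zero.2 h0, lt_top_iff_ne_top.2 ht⟩
      calc (volume C)⁻¹ * sliceSum C Φ Y ^ 2
          ≤ (volume C)⁻¹ * (ENNReal.ofReal κ * volume C * sliceSq C Φ Y) := by gcongr
        _ = ENNReal.ofReal κ * sliceSq C Φ Y := by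
            calc (volume C)⁻¹ * (ENNReal.ofReal κ * volume C * sliceSq C Φ Y)
                = ENNReal.ofReal κ * ((volume C)⁻¹ * volume C) * sliceSq C Φ Y := by ring
              _ = ENNReal.ofReal κ * sliceSq C Φ Y := by
                  rw [ENNReal.inv_mul_cancel hC0 hCtop, mul_one]
  -- integrate over the cell
  have hW1 : ∫⁻ Y in cellN m ℓ, sliceSq C Φ Y ≤ 1 :=
    (lintegral_cellN_sliceSq_le hΦm hC hCcell).trans hΦ1.le
  have hsum : ENNReal.ofReal c₁ ≤
      (∫⁻ Y in cellN m ℓ, G.indicator (sliceSq C Φ) Y) + ENNReal.ofReal κ := by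
    calc ENNReal.ofReal c₁ ≤ ∫⁻ Y in cellN m ℓ, (volume C)⁻¹ * sliceSum C Φ Y ^ 2 := hfloor'
      _ ≤ ∫⁻ Y in cellN m ℓ, (G.indicator (sliceSq C Φ) Y + ENNReal.ofReal κ * sliceSq C Φ Y) :=
          lintegral_mono fun Y => hpt Y
      _ = (∫⁻ Y in cellN m ℓ, G.indicator (sliceSq C Φ) Y) +
            ENNReal.ofReal κ * ∫⁻ Y in cellN m ℓ, sliceSq C Φ Y := by
          rw [lintegral_add_left (hmW.indicator hG), lintegral_const_mul _ hmW]
      _ ≤ (∫⁻ Y in cellN m ℓ, G.indicator (sliceSq C Φ) Y) + ENNReal.ofReal κ * 1 := by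
          gcongr
      _ = _ := by rw [mul_one]
  rw [ENNReal.ofReal_sub _ hκ.le]
  exact tsub_le_iff_right.2 hsum

/-- Cauchy–Schwarz on a set: `(∫_A u)² ≤ |A| ∫_A u²` for `u ≥ 0`. -/
theorem setLIntegral_ofReal_sq_le (A : Set Space) {u : Space → ℝ} (hu : Measurable u)
    (hu0 : ∀ x, 0 ≤ u x) :
    (∫⁻ x in A, ENNReal.ofReal (u x)) ^ 2 ≤ volume A * ∫⁻ x in A, ENNReal.ofReal (u x ^ 2) := by
  have h := lintegral_mul_sq_le (volume.restrict A) (f := fun x => ENNReal.ofReal (u x))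
    (g := fun _ => (1 : ℝ≥0∞)) (by fun_prop) (by fun_prop)
  simp only [mul_one, one_pow, lintegral_const, Measure.restrict_apply_univ, one_mul] at h
  calc (∫⁻ x in A, ENNReal.ofReal (u x)) ^ 2
      ≤ (∫⁻ x in A, ENNReal.ofReal (u x) ^ 2) * volume A := h
    _ = volume A * ∫⁻ x in A, ENNReal.ofReal (u x ^ 2) := by
        rw [mul_comm]
        congr 1
        refine lintegral_congr fun x => ?_
        rw [ENNReal.ofReal_pow (hu0 x)]

/-- **Tonelli on `A³`**: a pairwise multiplicative bound `f(x) g(y) ≤ e^M f(y) g(x)` on `A` gives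
`∫_A f² · (∫_A g)² ≤ e^{2M} (∫_A f)² ∫_A g²`. -/
theorem lintegral_pairwise_bound {A : Set Space} (hA : MeasurableSet A) {f g : Space → ℝ}
    (hf : Measurable f) (hg : Measurable g) (hf0 : ∀ x, 0 ≤ f x) (hg0 : ∀ x, 0 ≤ g x) {M : ℝ}
    (hpair : ∀ x ∈ A, ∀ y ∈ A, f x * g y ≤ Real.exp M * (f y * g x)) :
    (∫⁻ x in A, ENNReal.ofReal (f x ^ 2)) * (∫⁻ x in A, ENNReal.ofReal (g x)) ^ 2 ≤
      ENNReal.ofReal (Real.exp (2 * M)) *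
        ((∫⁻ x in A, ENNReal.ofReal (f x)) ^ 2 * ∫⁻ x in A, ENNReal.ofReal (g x ^ 2)) := by
  -- indicator versions on the whole space
  have hma : Measurable (A.indicator fun z => ENNReal.ofReal (f z ^ 2)) :=
    (ENNReal.measurable_ofReal.comp (hf.pow_const 2)).indicator hA
  have hmb : Measurable (A.indicator fun z => ENNReal.ofReal (g z)) :=
    (ENNReal.measurable_ofReal.comp hg).indicator hA
  have hma' : Measurable (A.indicator fun z => ENNReal.ofReal (f z)) :=
    (ENNReal.measurable_ofReal.comp hf).indicator hA
  have hmb' : Measurable (A.indicator fun z => ENNReal.ofReal (g z ^ 2)) :=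
    (ENNReal.measurable_ofReal.comp (hg.pow_const 2)).indicator hA
  rw [← lintegral_indicator hA, ← lintegral_indicator hA, ← lintegral_indicator hA,
    ← lintegral_indicator hA]
  generalize ha : (A.indicator fun z => ENNReal.ofReal (f z ^ 2)) = a at hma
  generalize hb : (A.indicator fun z => ENNReal.ofReal (g z)) = b at hmb
  generalize ha' : (A.indicator fun z => ENNReal.ofReal (f z)) = a' at hma'
  generalize hb' : (A.indicator fun z => ENNReal.ofReal (g z ^ 2)) = b' at hmb'
  generalize hE : ENNReal.ofReal (Real.exp (2 * M)) = E
  -- the pointwise inequality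
  have hpt : ∀ z x y, a z * b x * b y ≤ E * (a' x * a' y * b' z) := by
    intro z x y
    subst ha hb ha' hb' hE
    by_cases hz : z ∈ A
    · by_cases hx : x ∈ A
      · by_cases hy : y ∈ A
        · simp only [Set.indicator_of_mem hz, Set.indicator_of_mem hx, Set.indicator_of_mem hy]
          have e1 : ENNReal.ofReal (f z ^ 2) * ENNReal.ofReal (g x) * ENNReal.ofReal (g y) =
              ENNReal.ofReal (f z ^ 2 * g x * g y) := by
            rw [ENNReal.ofReal_mul (mul_nonneg (sq_nonneg _) (hg0 x)),
              ENNReal.ofReal_mul (sq_nonneg _)]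
          have e2 : ENNReal.ofReal (Real.exp (2 * M)) *
              (ENNReal.ofReal (f x) * ENNReal.ofReal (f y) * ENNReal.ofReal (g z ^ 2)) =
              ENNReal.ofReal (Real.exp (2 * M) * (f x * f y * g z ^ 2)) := by
            rw [ENNReal.ofReal_mul (Real.exp_pos _).le,
              ENNReal.ofReal_mul (mul_nonneg (hf0 x) (hf0 y)), ENNReal.ofReal_mul (hf0 x)]
          rw [e1, e2]
          refine ENNReal.ofReal_le_ofReal ?_
          have h1 := hpair z hz x hx
          have h2 := hpair z hz y hy
          have hmul := mul_le_mul h1 h2 (mul_nonneg (hf0 z) (hg0 y))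
            (mul_nonneg (Real.exp_pos _).le (mul_nonneg (hf0 x) (hg0 z)))
          calc f z ^ 2 * g x * g y = f z * g x * (f z * g y) := by ring
            _ ≤ Real.exp M * (f x * g z) * (Real.exp M * (f y * g z)) := hmul
            _ = Real.exp (2 * M) * (f x * f y * g z ^ 2) := by
                rw [show (2 : ℝ) * M = M + M by ring, Real.exp_add]; ring
        · simp [Set.indicator_of_notMem hy]
      · simp [Set.indicator_of_notMem hx]
    · simp [Set.indicator_of_notMem hz]
  -- Tonelli: expand both sides as triple integrals
  have hL : (∫⁻ z, a z) * (∫⁻ z, b z) ^ 2 = ∫⁻ z, ∫⁻ x, ∫⁻ y, a z * b x * b y := by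
    have h1 : ∀ z x, ∫⁻ y, a z * b x * b y = a z * b x * ∫⁻ y, b y := fun z x =>
      lintegral_const_mul _ hmb
    have h2 : ∀ z, ∫⁻ x, a z * b x * ∫⁻ y, b y = a z * ((∫⁻ x, b x) * ∫⁻ y, b y) := by
      intro z
      have : (fun x => a z * b x * ∫⁻ y, b y) = fun x => a z * (b x * ∫⁻ y, b y) := by
        funext x; ring
      rw [this, lintegral_const_mul _ (hmb.mul_const _), lintegral_mul_const _ hmb]
    simp_rw [h1, h2]
    rw [lintegral_mul_const _ hma, sq]
  have hR : E * ((∫⁻ z, a' z) ^ 2 * ∫⁻ z, b' z) =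
      ∫⁻ z, ∫⁻ x, ∫⁻ y, E * (a' x * a' y * b' z) := by
    have h1 : ∀ z x, ∫⁻ y, E * (a' x * a' y * b' z) = E * (a' x * b' z) * ∫⁻ y, a' y := by
      intro z x
      have : (fun y => E * (a' x * a' y * b' z)) = fun y => E * (a' x * b' z) * a' y := by
        funext y; ring
      rw [this, lintegral_const_mul _ hma']
    have h2 : ∀ z, ∫⁻ x, E * (a' x * b' z) * ∫⁻ y, a' y =
        E * b' z * (∫⁻ y, a' y) * ∫⁻ x, a' x := by
      intro z
      have : (fun x => E * (a' x * b' z) * ∫⁻ y, a' y) =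
          fun x => E * b' z * (∫⁻ y, a' y) * a' x := by
        funext x; ring
      rw [this, lintegral_const_mul _ hma']
    have h3 : (fun z => E * b' z * (∫⁻ y, a' y) * ∫⁻ x, a' x) =
        fun z => E * ((∫⁻ y, a' y) * ∫⁻ x, a' x) * b' z := by
      funext z; ring
    simp_rw [h1, h2]
    rw [h3, lintegral_const_mul _ hmb', sq]
    ring
  rw [hL, hR]
  exact lintegral_mono fun z => lintegral_mono fun x => lintegral_mono fun y => hpt z x y

/-- The real-variable core of the flatness transfer. -/
theorem flatness_transfer_real {v wf tf mg sg wf' tf' mg' sg' wS mS d vS ε κ M : ℝ}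
    (hv0 : 0 < v) (hwf0 : 0 < wf) (hmg0 : 0 < mg) (hd0 : 0 ≤ d) (_hsg'0 : 0 ≤ sg')
    (htf'0 : 0 ≤ tf') (hmg'0 : 0 ≤ mg') (hwf'0 : 0 ≤ wf') (hmS0 : 0 ≤ mS) (hsg0 : 0 ≤ sg)
    (hε : 0 ≤ ε) (hε1 : ε < 1) (hκ : 0 ≤ κ) (hεκ : ε ≤ Real.sqrt κ)
    (r1 : wf' * sg' ^ 2 ≤ Real.exp (2 * M) * (tf' ^ 2 * mg')) (r2 : tf' ≤ tf) (r3 : mg' ≤ mg)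
    (r4 : wf = wf' + wS) (r5 : wS ≤ ε * wf) (r6 : sg = sg' + d) (r7 : d ^ 2 ≤ vS * mS)
    (r8 : vS ≤ ε * v) (r9 : mS ≤ ε * mg) (r10 : κ * v * mg ≤ sg ^ 2) :
    Real.exp (-2 * M) * (1 - ε) * (Real.sqrt κ - ε) ^ 2 ≤ tf ^ 2 / (v * wf) := by
  set r := Real.sqrt (v * mg) with hr
  have hr0 : 0 ≤ r := Real.sqrt_nonneg _
  have hr2 : r ^ 2 = v * mg := Real.sq_sqrt (by positivity)
  have hdle : d ≤ ε * r := by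
    have h1 : d ^ 2 ≤ (ε * r) ^ 2 := by
      calc d ^ 2 ≤ vS * mS := r7
        _ ≤ (ε * v) * (ε * mg) := mul_le_mul r8 r9 hmS0 (by positivity)
        _ = (ε * r) ^ 2 := by rw [mul_pow, hr2]; ring
    calc d = Real.sqrt (d ^ 2) := (Real.sqrt_sq hd0).symm
      _ ≤ Real.sqrt ((ε * r) ^ 2) := Real.sqrt_le_sqrt h1
      _ = ε * r := Real.sqrt_sq (by positivity)
  have hsgge : Real.sqrt κ * r ≤ sg := by
    have h1 : (Real.sqrt κ * r) ^ 2 ≤ sg ^ 2 := by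
      rw [mul_pow, Real.sq_sqrt hκ, hr2, ← mul_assoc]; exact r10
    calc Real.sqrt κ * r = Real.sqrt ((Real.sqrt κ * r) ^ 2) := (Real.sqrt_sq (by positivity)).symm
      _ ≤ Real.sqrt (sg ^ 2) := Real.sqrt_le_sqrt h1
      _ = sg := Real.sqrt_sq hsg0
  have hq0 : 0 ≤ (Real.sqrt κ - ε) * r := mul_nonneg (sub_nonneg.2 hεκ) hr0
  have hsg'ge : (Real.sqrt κ - ε) * r ≤ sg' := by
    have e : (Real.sqrt κ - ε) * r = Real.sqrt κ * r - ε * r := by ring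
    rw [e]; linarith
  have hsg'2 : (Real.sqrt κ - ε) ^ 2 * (v * mg) ≤ sg' ^ 2 := by
    calc (Real.sqrt κ - ε) ^ 2 * (v * mg) = ((Real.sqrt κ - ε) * r) ^ 2 := by rw [mul_pow, hr2]
      _ ≤ sg' ^ 2 := pow_le_pow_left₀ hq0 hsg'ge 2
  have hwf'ge : (1 - ε) * wf ≤ wf' := by
    have e : (1 - ε) * wf = wf - ε * wf := by ring
    rw [e]; linarith
  have htf'2 : tf' ^ 2 ≤ tf ^ 2 := pow_le_pow_left₀ htf'0 r2 2
  have hε1' : 0 ≤ 1 - ε := by linarith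
  have hmain : (1 - ε) * (Real.sqrt κ - ε) ^ 2 * v * wf * mg ≤ Real.exp (2 * M) * tf ^ 2 * mg := by
    calc (1 - ε) * (Real.sqrt κ - ε) ^ 2 * v * wf * mg
        = ((1 - ε) * wf) * ((Real.sqrt κ - ε) ^ 2 * (v * mg)) := by ring
      _ ≤ wf' * sg' ^ 2 := mul_le_mul hwf'ge hsg'2 (by positivity) hwf'0
      _ ≤ Real.exp (2 * M) * (tf' ^ 2 * mg') := r1
      _ ≤ Real.exp (2 * M) * (tf ^ 2 * mg) := by
          refine mul_le_mul_of_nonneg_left ?_ (Real.exp_pos _).le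
          exact mul_le_mul htf'2 r3 hmg'0 (by positivity)
      _ = Real.exp (2 * M) * tf ^ 2 * mg := by ring
  have hmain' : (1 - ε) * (Real.sqrt κ - ε) ^ 2 * v * wf ≤ Real.exp (2 * M) * tf ^ 2 :=
    le_of_mul_le_mul_right hmain hmg0
  rw [le_div_iff₀ (by positivity)]
  have hexp : Real.exp (-2 * M) * Real.exp (2 * M) = 1 := by
    rw [← Real.exp_add]; simp
  calc Real.exp (-2 * M) * (1 - ε) * (Real.sqrt κ - ε) ^ 2 * (v * wf)
      = Real.exp (-2 * M) * ((1 - ε) * (Real.sqrt κ - ε) ^ 2 * v * wf) := by ring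
    _ ≤ Real.exp (-2 * M) * (Real.exp (2 * M) * tf ^ 2) :=
        mul_le_mul_of_nonneg_left hmain' (Real.exp_pos _).le
    _ = tf ^ 2 := by rw [← mul_assoc, hexp, one_mul]

/-- The `ℝ≥0∞`-variable core of the flatness transfer (finiteness bookkeeping, then
`flatness_transfer_real`). -/
theorem flatness_transfer_ennreal {V Wf Tf Mg Sg Wf' Tf' Mg' Sg' WS MS D VS : ℝ≥0∞} {ε κ M : ℝ}
    (hV0 : V ≠ 0) (hVtop : V ≠ ⊤) (hW0 : Wf ≠ 0) (hWtop : Wf ≠ ⊤) (hM0 : Mg ≠ 0) (hMtop : Mg ≠ ⊤)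
    (hε : 0 ≤ ε) (hε1 : ε < 1) (hκ : 0 ≤ κ) (hεκ : ε ≤ Real.sqrt κ)
    (hWsplit : Wf = Wf' + WS) (hSsplit : Sg = Sg' + D) (hTle : Tf' ≤ Tf) (hMle : Mg' ≤ Mg)
    (hL1 : Wf' * Sg' ^ 2 ≤ ENNReal.ofReal (Real.exp (2 * M)) * (Tf' ^ 2 * Mg'))
    (hD2 : D ^ 2 ≤ VS * MS) (hTf2 : Tf ^ 2 ≤ V * Wf) (hSg2 : Sg ^ 2 ≤ V * Mg)
    (hvol : VS ≤ ENNReal.ofReal ε * V) (hfS : WS ≤ ENNReal.ofReal ε * Wf)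
    (hgS : MS ≤ ENNReal.ofReal ε * Mg) (hgflat : ENNReal.ofReal κ * V * Mg ≤ Sg ^ 2) :
    ENNReal.ofReal (Real.exp (-2 * M) * (1 - ε) * (Real.sqrt κ - ε) ^ 2) ≤ Tf ^ 2 / (V * Wf) := by
  -- finiteness
  have hTtop : Tf ≠ ⊤ := by
    intro h
    rw [h, ENNReal.top_pow two_ne_zero] at hTf2
    exact ENNReal.mul_ne_top hVtop hWtop (le_antisymm le_top hTf2)
  have hStop : Sg ≠ ⊤ := by
    intro h
    rw [h, ENNReal.top_pow two_ne_zero] at hSg2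
    exact ENNReal.mul_ne_top hVtop hMtop (le_antisymm le_top hSg2)
  have hT'top : Tf' ≠ ⊤ := ne_top_of_le_ne_top hTtop hTle
  have hM'top : Mg' ≠ ⊤ := ne_top_of_le_ne_top hMtop hMle
  have hW'top : Wf' ≠ ⊤ := ne_top_of_le_ne_top hWtop (hWsplit ▸ le_self_add)
  have hWStop : WS ≠ ⊤ := ne_top_of_le_ne_top hWtop (hWsplit ▸ le_add_self)
  have hS'top : Sg' ≠ ⊤ := ne_top_of_le_ne_top hStop (hSsplit ▸ le_self_add)
  have hDtop : D ≠ ⊤ := ne_top_of_le_ne_top hStop (hSsplit ▸ le_add_self)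
  have hVStop : VS ≠ ⊤ :=
    ne_top_of_le_ne_top (ENNReal.mul_ne_top ENNReal.ofReal_ne_top hVtop) hvol
  have hMStop : MS ≠ ⊤ := ne_top_of_le_ne_top (ENNReal.mul_ne_top ENNReal.ofReal_ne_top hMtop) hgS
  have hEtop : ENNReal.ofReal (Real.exp (2 * M)) ≠ ⊤ := ENNReal.ofReal_ne_top
  -- the real facts
  have r1 : Wf'.toReal * Sg'.toReal ^ 2 ≤ Real.exp (2 * M) * (Tf'.toReal ^ 2 * Mg'.toReal) := by
    have h := (ENNReal.toReal_le_toReal (ENNReal.mul_ne_top hW'top (ENNReal.pow_ne_top hS'top))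
      (ENNReal.mul_ne_top hEtop (ENNReal.mul_ne_top (ENNReal.pow_ne_top hT'top) hM'top))).2 hL1
    rw [ENNReal.toReal_mul, ENNReal.toReal_pow, ENNReal.toReal_mul, ENNReal.toReal_mul,
      ENNReal.toReal_pow, ENNReal.toReal_ofReal (Real.exp_pos _).le] at h
    exact h
  have r2 : Tf'.toReal ≤ Tf.toReal := (ENNReal.toReal_le_toReal hT'top hTtop).2 hTle
  have r3 : Mg'.toReal ≤ Mg.toReal := (ENNReal.toReal_le_toReal hM'top hMtop).2 hMle
  have r4 : Wf.toReal = Wf'.toReal + WS.toReal := by rw [hWsplit, ENNReal.toReal_add hW'top hWStop]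
  have r5 : WS.toReal ≤ ε * Wf.toReal := by
    have h := (ENNReal.toReal_le_toReal hWStop (ENNReal.mul_ne_top ENNReal.ofReal_ne_top hWtop)).2 hfS
    rwa [ENNReal.toReal_mul, ENNReal.toReal_ofReal hε] at h
  have r6 : Sg.toReal = Sg'.toReal + D.toReal := by rw [hSsplit, ENNReal.toReal_add hS'top hDtop]
  have r7 : D.toReal ^ 2 ≤ VS.toReal * MS.toReal := by
    have h := (ENNReal.toReal_le_toReal (ENNReal.pow_ne_top hDtop)
      (ENNReal.mul_ne_top hVStop hMStop)).2 hD2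
    rwa [ENNReal.toReal_pow, ENNReal.toReal_mul] at h
  have r8 : VS.toReal ≤ ε * V.toReal := by
    have h := (ENNReal.toReal_le_toReal hVStop (ENNReal.mul_ne_top ENNReal.ofReal_ne_top hVtop)).2 hvol
    rwa [ENNReal.toReal_mul, ENNReal.toReal_ofReal hε] at h
  have r9 : MS.toReal ≤ ε * Mg.toReal := by
    have h := (ENNReal.toReal_le_toReal hMStop (ENNReal.mul_ne_top ENNReal.ofReal_ne_top hMtop)).2 hgS
    rwa [ENNReal.toReal_mul, ENNReal.toReal_ofReal hε] at h
  have r10 : κ * V.toReal * Mg.toReal ≤ Sg.toReal ^ 2 := by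
    have h := (ENNReal.toReal_le_toReal
      (ENNReal.mul_ne_top (ENNReal.mul_ne_top ENNReal.ofReal_ne_top hVtop) hMtop)
      (ENNReal.pow_ne_top hStop)).2 hgflat
    rwa [ENNReal.toReal_mul, ENNReal.toReal_mul, ENNReal.toReal_ofReal hκ, ENNReal.toReal_pow] at h
  have hgoal := flatness_transfer_real (ENNReal.toReal_pos hV0 hVtop) (ENNReal.toReal_pos hW0 hWtop)
    (ENNReal.toReal_pos hM0 hMtop) ENNReal.toReal_nonneg ENNReal.toReal_nonneg ENNReal.toReal_nonneg
    ENNReal.toReal_nonneg ENNReal.toReal_nonneg ENNReal.toReal_nonneg ENNReal.toReal_nonneg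
    hε hε1 hκ hεκ r1 r2 r3 r4 r5 r6 r7 r8 r9 r10
  -- back to `ℝ≥0∞`
  have hquot : Tf ^ 2 / (V * Wf) ≠ ⊤ :=
    ENNReal.div_ne_top (ENNReal.pow_ne_top hTtop) (mul_ne_zero hV0 hW0)
  rw [ENNReal.ofReal_le_iff_le_toReal hquot, ENNReal.toReal_div, ENNReal.toReal_pow,
    ENNReal.toReal_mul]
  exact hgoal

/-- **In-measure multiplicative flatness transfer** (Tonelli on `(C ∖ S)³` plus mass bookkeeping):
two nonnegative functions that are pairwise multiplicatively comparable off a small exceptional set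
have comparable Bhattacharyya flatness on `C`. -/
theorem flatness_transfer {C S : Set Space} (hC : MeasurableSet C) (hS : MeasurableSet S)
    (hSC : S ⊆ C) (hC0 : volume C ≠ 0) (hCtop : volume C ≠ ⊤) {f g : Space → ℝ}
    (hf : Measurable f) (hg : Measurable g) (hf0 : ∀ x, 0 ≤ f x) (hg0 : ∀ x, 0 ≤ g x)
    {ε κ M : ℝ} (hε : 0 ≤ ε) (hε1 : ε < 1) (hκ : 0 ≤ κ) (hεκ : ε ≤ Real.sqrt κ)
    (hvol : volume S ≤ ENNReal.ofReal ε * volume C)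
    (hfS : ∫⁻ x in S, ENNReal.ofReal (f x ^ 2) ≤ ENNReal.ofReal ε * ∫⁻ x in C, ENNReal.ofReal (f x ^ 2))
    (hgS : ∫⁻ x in S, ENNReal.ofReal (g x ^ 2) ≤ ENNReal.ofReal ε * ∫⁻ x in C, ENNReal.ofReal (g x ^ 2))
    (hpair : ∀ x ∈ C \ S, ∀ y ∈ C \ S, f x * g y ≤ Real.exp M * (f y * g x))
    (hgflat : ENNReal.ofReal κ * volume C * ∫⁻ x in C, ENNReal.ofReal (g x ^ 2) ≤
      (∫⁻ x in C, ENNReal.ofReal (g x)) ^ 2)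
    (hgpos : 0 < ∫⁻ x in C, ENNReal.ofReal (g x ^ 2)) (hgtop : ∫⁻ x in C, ENNReal.ofReal (g x ^ 2) < ⊤)
    (hfpos : 0 < ∫⁻ x in C, ENNReal.ofReal (f x ^ 2)) (hftop : ∫⁻ x in C, ENNReal.ofReal (f x ^ 2) < ⊤) :
    ENNReal.ofReal (Real.exp (-2 * M) * (1 - ε) * (Real.sqrt κ - ε) ^ 2) ≤
      (∫⁻ x in C, ENNReal.ofReal (f x)) ^ 2 / (volume C * ∫⁻ x in C, ENNReal.ofReal (f x ^ 2)) := by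
  have hCS : MeasurableSet (C \ S) := hC.diff hS
  have hunion : C \ S ∪ S = C := Set.sdiff_union_of_subset hSC
  have hdisj : Disjoint (C \ S) S := Set.disjoint_sdiff_left
  have hWsplit : ∫⁻ x in C, ENNReal.ofReal (f x ^ 2) =
      (∫⁻ x in C \ S, ENNReal.ofReal (f x ^ 2)) + ∫⁻ x in S, ENNReal.ofReal (f x ^ 2) := by
    conv_lhs => rw [← hunion]
    exact lintegral_union hS hdisj
  have hSsplit : ∫⁻ x in C, ENNReal.ofReal (g x) =
      (∫⁻ x in C \ S, ENNReal.ofReal (g x)) + ∫⁻ x in S, ENNReal.ofReal (g x) := by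
    conv_lhs => rw [← hunion]
    exact lintegral_union hS hdisj
  exact flatness_transfer_ennreal hC0 hCtop hfpos.ne' hftop.ne hgpos.ne' hgtop.ne hε hε1 hκ hεκ
    hWsplit hSsplit (lintegral_mono_set Set.sdiff_subset) (lintegral_mono_set Set.sdiff_subset)
    (lintegral_pairwise_bound hCS hf hg hf0 hg0 hpair) (setLIntegral_ofReal_sq_le S hg hg0)
    (setLIntegral_ofReal_sq_le C hf hf0) (setLIntegral_ofReal_sq_le C hg hg0) hvol hfS hgS hgflat

end Core

/-! ## The assembly -/

section Assembly

variable {m : ℕ}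

/-- `‖(r : ℂ)‖² = ofReal (r²)` in `ℝ≥0∞`. -/
theorem ennnorm_sq_coe_real (r : ℝ) : (‖(r : ℂ)‖₊ : ℝ≥0∞) ^ 2 = ENNReal.ofReal (r ^ 2) := by
  rw [coe_nnnorm_sq_eq_ofReal, Complex.norm_real, Real.norm_eq_abs, sq_abs]

/-- Slice square masses integrate to at most the full square norm. -/
theorem lintegral_sliceSq_le {F : Config (m + 1) → ℝ} (hF : Measurable F) (C : Set Space) :
    ∫⁻ Y, sliceSq C F Y ≤ ∫⁻ X, ENNReal.ofReal (F X ^ 2) := by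
  have hmeas : Measurable fun X : Config (m + 1) => ENNReal.ofReal (F X ^ 2) :=
    ENNReal.measurable_ofReal.comp (hF.pow_const 2)
  rw [lintegral_config_succ hmeas]
  exact lintegral_mono fun Y => setLIntegral_le_lintegral _ _

/-- **The fixed-`N` estimate, floor form** (typing-agnostic on the torus side): at one `N = m+1` and one
side `L`, finiteness of `E₀^D`, ANY continuous nonnegative cell-normalised `Φ` whose inner-cube flat
occupation is floored by `(c/16)(m+1)` (for the interface this is `stub_torusFloorFromA`; for the modulus
of a translated periodic near-minimiser it is the pigeonhole of line `Sketch`), and a coupling with the good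
event of `CoupledRelocationBound` for this `Φ`, give a macroscopic inner-cube flat-mode occupation of the
Dirichlet ground state. -/
theorem innerMode_occupation_ge_of_floor {v : ℝ → ℝ≥0∞} {L : ℝ} (hL : 0 < L)
    {c ε M : ℝ} (hc : 0 < c) (hc1 : c ≤ 1) (hε : 0 < ε) (hε1 : ε < 1)
    (hεκ : ε ≤ Real.sqrt (c / 32))
    (hE0 : groundStateEnergy v (m + 1) L ≠ ⊤) {Φ : Config (m + 1) → ℝ}
    (hΦc : Continuous Φ) (hΦ0 : ∀ X, 0 ≤ Φ X)
    (hΦ1' : ∫⁻ X in cellN (m + 1) L, ENNReal.ofReal (Φ X ^ 2) = 1)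
    (hfloorΦ : ENNReal.ofReal (c / 16 * (m + 1 : ℕ)) ≤
      cellOccupation (m + 1) L (innerMode L) fun X => (Φ X : ℂ))
    {π : Measure (Config (m + 1) × Config (m + 1))}
    (hπ1 : π.map Prod.fst = boxLaw v m L) (hπ2 : π.map Prod.snd = torusLaw m L Φ)
    {G : Set (Config (m + 1) × Config (m + 1))} (hGm : MeasurableSet G)
    (hπG : ENNReal.ofReal (1 - c / 64) ≤ π G)
    (hGood : ∀ p ∈ G, GoodPair L (groundState v (m + 1) L) Φ ε M p) :
    ENNReal.ofReal (Real.exp (-2 * M) * (1 - ε) * (Real.sqrt (c / 32) - ε) ^ 2 * (c / 64) *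
        (m + 1 : ℕ)) ≤
      occupation (m + 1) (innerMode L) (fun X => (groundState v (m + 1) L X : ℂ)) := by
  -- notation and basic facts
  set C := innerCube L with hCdef
  set F := groundState v (m + 1) L with hFdef
  have hCm : MeasurableSet C := measurableSet_innerCube L
  have hCcell : C ⊆ cell L := innerCube_subset_cell L
  have hV : volume C = ENNReal.ofReal (L / 2) ^ 3 := volume_innerCube L
  have hV0 : volume C ≠ 0 := by
    rw [hV]; exact pow_ne_zero _ (ENNReal.ofReal_pos.2 (half_pos hL)).ne'
  have hVtop : volume C ≠ ⊤ := by rw [hV]; exact ENNReal.pow_ne_top ENNReal.ofReal_ne_top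
  have hVreal : (volume C).toReal = (L / 2) ^ 3 := by
    rw [hV, ENNReal.toReal_pow, ENNReal.toReal_ofReal (half_pos hL).le]
  have hmode : innerMode L = C.indicator fun _ => ((Real.sqrt (volume C).toReal)⁻¹ : ℂ) := by
    rw [hVreal]; rfl
  have hFm : Measurable F := measurable_groundState v (m + 1) L
  have hF0 : ∀ X, 0 ≤ F X := groundState_nonneg v (m + 1) L
  have hF1 : ∫⁻ X, ENNReal.ofReal (F X ^ 2) = 1 := by
    rw [← Theorems.BECInsertionVariance.lintegral_groundState_sq_of_ne_top hE0]
    exact lintegral_congr fun X => ENNReal.ofReal_pow (hF0 X) 2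
  have hΦm : Measurable Φ := hΦc.measurable
  have hβ0 : 0 ≤ Real.exp (-2 * M) * (1 - ε) * (Real.sqrt (c / 32) - ε) ^ 2 :=
    mul_nonneg (mul_nonneg (Real.exp_pos _).le (by linarith)) (sq_nonneg _)
  -- Step 1: the floor, in the `|C|`-normalised form
  have hfloor' : ENNReal.ofReal (c / 16 * (m + 1 : ℕ)) ≤
      cellOccupation (m + 1) L (C.indicator fun _ => ((Real.sqrt (volume C).toReal)⁻¹ : ℂ))
        (fun X => (Φ X : ℂ)) := by
    rw [← hmode]; exact hfloorΦ
  -- Step 2: torus typicality (reverse Markov)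
  have hPE := torusLaw_flatEvent_ge hΦc hΦ0 hΦ1' hCm hCcell hV0 hVtop (c₁ := c / 16)
    (κ := c / 32) (by positivity) hfloor'
  rw [show c / 16 - c / 32 = c / 32 by ring] at hPE
  -- Step 3: box disintegration
  have hocc := occupation_indicator_ge_lintegral_flatness (m := m) hFm hF0 hCm hV0 hVtop
  rw [← hmode] at hocc
  -- reduction to the coupling estimate
  suffices hmain : ENNReal.ofReal (Real.exp (-2 * M) * (1 - ε) * (Real.sqrt (c / 32) - ε) ^ 2 *
      (c / 64)) ≤
      ∫⁻ X, {X : Config (m + 1) | X 0 ∈ C}.indicator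
        (fun X => sliceSum C F (Fin.tail X) ^ 2 / (volume C * sliceSq C F (Fin.tail X)) *
          ENNReal.ofReal (F X ^ 2)) X by
    calc ENNReal.ofReal (Real.exp (-2 * M) * (1 - ε) * (Real.sqrt (c / 32) - ε) ^ 2 * (c / 64) *
          (m + 1 : ℕ))
        = (m + 1 : ℝ≥0∞) * ENNReal.ofReal (Real.exp (-2 * M) * (1 - ε) *
            (Real.sqrt (c / 32) - ε) ^ 2 * (c / 64)) := by
          rw [ENNReal.ofReal_mul' (Nat.cast_nonneg _), ENNReal.ofReal_natCast, mul_comm]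
          push_cast
          ring
      _ ≤ (m + 1 : ℝ≥0∞) * ∫⁻ X, {X : Config (m + 1) | X 0 ∈ C}.indicator
          (fun X => sliceSum C F (Fin.tail X) ^ 2 / (volume C * sliceSq C F (Fin.tail X)) *
            ENNReal.ofReal (F X ^ 2)) X := by gcongr
      _ ≤ _ := hocc
  -- the integrand against the box law, then against `π`
  set h : Config m → ℝ≥0∞ := fun Y => sliceSum C F Y ^ 2 / (volume C * sliceSq C F Y) with hh
  set I : Config (m + 1) → ℝ≥0∞ :=
    {X : Config (m + 1) | X 0 ∈ C}.indicator fun X => h (Fin.tail X) with hI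
  have hmS := measurable_sliceSum (m := m) hCm hFm
  have hmW := measurable_sliceSq (m := m) hCm hFm
  have hmh : Measurable h := (hmS.pow_const 2).div (hmW.const_mul _)
  have htail : Measurable fun X : Config (m + 1) => Fin.tail X :=
    measurable_pi_lambda _ fun i => measurable_pi_apply _
  have hT : MeasurableSet {X : Config (m + 1) | X 0 ∈ C} := measurable_pi_apply 0 hCm
  have hIm : Measurable I := (hmh.comp htail).indicator hT
  have hmeasF : Measurable fun X : Config (m + 1) => ENNReal.ofReal (F X ^ 2) :=
    ENNReal.measurable_ofReal.comp (hFm.pow_const 2)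
  have hint_eq : ∫⁻ X, {X : Config (m + 1) | X 0 ∈ C}.indicator
      (fun X => sliceSum C F (Fin.tail X) ^ 2 / (volume C * sliceSq C F (Fin.tail X)) *
        ENNReal.ofReal (F X ^ 2)) X = ∫⁻ p, I p.1 ∂π := by
    have h1 : (fun X => {X : Config (m + 1) | X 0 ∈ C}.indicator
        (fun X => sliceSum C F (Fin.tail X) ^ 2 / (volume C * sliceSq C F (Fin.tail X)) *
          ENNReal.ofReal (F X ^ 2)) X) = fun X => ENNReal.ofReal (F X ^ 2) * I X := by
      funext X
      by_cases hX : X ∈ {X : Config (m + 1) | X 0 ∈ C}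
      · simp only [hI, hh, Set.indicator_of_mem hX]; ring
      · simp only [hI, Set.indicator_of_notMem hX, mul_zero]
    have h2 : ∫⁻ X, I X ∂(boxLaw v m L) = ∫⁻ X, ENNReal.ofReal (F X ^ 2) * I X := by
      change ∫⁻ X, I X ∂(volume.withDensity fun X => ENNReal.ofReal (F X ^ 2)) = _
      rw [lintegral_withDensity_eq_lintegral_mul _ hmeasF hIm]
      rfl
    rw [h1, ← h2, ← hπ1, lintegral_map hIm measurable_fst]
  rw [hint_eq]
  -- the events
  set Gκ : Set (Config m) := {Y | ENNReal.ofReal (c / 32) * volume C * sliceSq C Φ Y ≤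
    sliceSum C Φ Y ^ 2 ∧ 0 < sliceSq C Φ Y ∧ sliceSq C Φ Y < ⊤} with hGκ
  set E : Set (Config (m + 1)) := {X | X 0 ∈ C ∧ Fin.tail X ∈ Gκ} with hEdef
  set Dbad : Set (Config (m + 1)) :=
    {X | X 0 ∈ C ∧ ¬ (0 < sliceSq C F (Fin.tail X) ∧ sliceSq C F (Fin.tail X) < ⊤)} with hDbad
  set T : Set (Config (m + 1) × Config (m + 1)) := (G ∩ Prod.snd ⁻¹' E) \ Prod.fst ⁻¹' Dbad
    with hTdef
  have hmSΦ := measurable_sliceSum (m := m) hCm hΦm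
  have hmWΦ := measurable_sliceSq (m := m) hCm hΦm
  have hGκm : MeasurableSet Gκ :=
    (measurableSet_le (hmWΦ.const_mul _) (hmSΦ.pow_const 2)).inter
      ((measurableSet_lt measurable_const hmWΦ).inter (measurableSet_lt hmWΦ measurable_const))
  have hEm : MeasurableSet E := hT.inter (htail hGκm)
  have hDm : MeasurableSet Dbad :=
    hT.inter ((measurableSet_lt measurable_const (hmW.comp htail)).inter
      (measurableSet_lt (hmW.comp htail) measurable_const)).compl
  have hTm : MeasurableSet T :=
    (hGm.inter (measurable_snd hEm)).diff (measurable_fst hDm)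
  -- `π` is a probability measure
  have hπuniv : π Set.univ = 1 := by
    have h1 : π Set.univ = (π.map Prod.snd) Set.univ := by
      rw [Measure.map_apply measurable_snd MeasurableSet.univ, Set.preimage_univ]
    rw [h1, hπ2, torusLaw, withDensity_apply _ MeasurableSet.univ, Measure.restrict_univ]
    exact hΦ1'
  -- the bad torus-side event has probability `≤ c/64`
  have hGc : π Gᶜ ≤ ENNReal.ofReal (c / 64) := by
    have hfin : π G ≠ ⊤ :=
      ne_top_of_le_ne_top ENNReal.one_ne_top (hπuniv ▸ measure_mono (Set.subset_univ _))
    rw [measure_compl hGm hfin, hπuniv]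
    calc 1 - π G ≤ 1 - ENNReal.ofReal (1 - c / 64) := tsub_le_tsub_left hπG _
      _ = ENNReal.ofReal (c / 64) := by
          rw [← ENNReal.ofReal_one, ← ENNReal.ofReal_sub _ (by linarith : (0 : ℝ) ≤ 1 - c / 64)]
          congr 1; ring
  -- the degenerate box-side event is null
  have hDnull : π (Prod.fst ⁻¹' Dbad) = 0 := by
    rw [← Measure.map_apply measurable_fst hDm, hπ1, boxLaw, withDensity_apply _ hDm]
    change ∫⁻ X in Dbad, ENNReal.ofReal (F X ^ 2) = 0
    rw [← lintegral_indicator hDm, lintegral_config_succ (hmeasF.indicator hDm)]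
    set bad : Set (Config m) := {Y | ¬ (0 < sliceSq C F Y ∧ sliceSq C F Y < ⊤)} with hbad
    have hinner : ∀ Y, ∫⁻ x, Dbad.indicator (fun X => ENNReal.ofReal (F X ^ 2)) (Matrix.vecCons x Y) =
        bad.indicator (sliceSq C F) Y := by
      intro Y
      by_cases hY : Y ∈ bad
      · rw [Set.indicator_of_mem hY, sliceSq, ← lintegral_indicator hCm]
        refine lintegral_congr fun x => ?_
        by_cases hx : x ∈ C
        · have : Matrix.vecCons x Y ∈ Dbad := by
            refine ⟨by simpa using hx, ?_⟩
            show ¬ (0 < sliceSq C F (Fin.tail (Matrix.vecCons x Y)) ∧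
              sliceSq C F (Fin.tail (Matrix.vecCons x Y)) < ⊤)
            rw [tail_vecCons]
            exact hY
          rw [Set.indicator_of_mem this, Set.indicator_of_mem hx]
        · have : Matrix.vecCons x Y ∉ Dbad := fun h => hx (by simpa using h.1)
          rw [Set.indicator_of_notMem this, Set.indicator_of_notMem hx]
      · rw [Set.indicator_of_notMem hY]
        have : ∀ x, Dbad.indicator (fun X => ENNReal.ofReal (F X ^ 2)) (Matrix.vecCons x Y) = 0 := by
          intro x
          refine Set.indicator_of_notMem (fun h => hY ?_) _
          have h2 := h.2
          rw [tail_vecCons] at h2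
          exact h2
        simp_rw [this]
        exact lintegral_zero
    simp_rw [hinner]
    -- on `bad`, the slice mass is `0` or `⊤`; the latter happens on a null set
    have hfin : ∫⁻ Y, sliceSq C F Y ≠ ⊤ :=
      ne_top_of_le_ne_top (by rw [hF1]; exact ENNReal.one_ne_top) (lintegral_sliceSq_le hFm C)
    have hnull : volume {Y : Config m | sliceSq C F Y = ⊤} = 0 := by
      have := ae_lt_top hmW hfin
      rw [ae_iff] at this
      simpa only [not_lt, top_le_iff] using this
    have hle : ∀ Y, bad.indicator (sliceSq C F) Y ≤
        {Y : Config m | sliceSq C F Y = ⊤}.indicator (sliceSq C F) Y := by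
      intro Y
      by_cases hY : Y ∈ bad
      · rw [Set.indicator_of_mem hY]
        rcases eq_or_ne (sliceSq C F Y) 0 with h0 | h0
        · rw [h0]; exact zero_le
        · have htop : sliceSq C F Y = ⊤ := by
            by_contra hne
            exact hY ⟨pos_iff_ne_zero.2 h0, lt_top_iff_ne_top.2 hne⟩
          rw [Set.indicator_of_mem (show Y ∈ {Y : Config m | sliceSq C F Y = ⊤} from htop)]
      · rw [Set.indicator_of_notMem hY]; exact zero_le
    refine le_antisymm ?_ zero_le
    calc ∫⁻ Y, bad.indicator (sliceSq C F) Y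
        ≤ ∫⁻ Y, {Y : Config m | sliceSq C F Y = ⊤}.indicator (sliceSq C F) Y := lintegral_mono hle
      _ = ∫⁻ Y in {Y : Config m | sliceSq C F Y = ⊤}, sliceSq C F Y :=
          lintegral_indicator (measurableSet_eq_fun hmW measurable_const) _
      _ = 0 := setLIntegral_measure_zero _ _ hnull
  -- the good set `T` has probability `≥ c/64`
  have hTbound : ENNReal.ofReal (c / 64) ≤ π T := by
    have hE' : ENNReal.ofReal (c / 32) ≤ π (Prod.snd ⁻¹' E) := by
      rw [← Measure.map_apply measurable_snd hEm, hπ2]; exact hPE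
    have hsub : Prod.snd ⁻¹' E ⊆ T ∪ (Prod.fst ⁻¹' Dbad ∪ Gᶜ) := by
      intro p hp
      by_cases hG : p ∈ G
      · by_cases hD : p ∈ Prod.fst ⁻¹' Dbad
        · exact Or.inr (Or.inl hD)
        · exact Or.inl ⟨⟨hG, hp⟩, hD⟩
      · exact Or.inr (Or.inr hG)
    have h1 : π (Prod.snd ⁻¹' E) ≤ π T + (π (Prod.fst ⁻¹' Dbad) + π Gᶜ) :=
      (measure_mono hsub).trans ((measure_union_le _ _).trans
        (add_le_add le_rfl (measure_union_le _ _)))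
    rw [hDnull, zero_add] at h1
    have h2 : ENNReal.ofReal (c / 32) ≤ π T + ENNReal.ofReal (c / 64) :=
      hE'.trans (h1.trans (add_le_add le_rfl hGc))
    have h3 : ENNReal.ofReal (c / 64) = ENNReal.ofReal (c / 32) - ENNReal.ofReal (c / 64) := by
      rw [← ENNReal.ofReal_sub _ (by positivity : (0 : ℝ) ≤ c / 64)]; congr 1; ring
    rw [h3]
    exact tsub_le_iff_right.2 h2
  -- pointwise bound on `T` by the flatness transfer
  have hptT : ∀ p ∈ T, ENNReal.ofReal (Real.exp (-2 * M) * (1 - ε) * (Real.sqrt (c / 32) - ε) ^ 2) ≤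
      I p.1 := by
    rintro p ⟨⟨hpG, hpE⟩, hpD⟩
    obtain ⟨hiff, S, hSC, hSm, hvol, hfS, hgS, hpair⟩ := hGood p hpG
    obtain ⟨hp2C, hGk⟩ := hpE
    have hp1C : p.1 0 ∈ C := hiff.2 hp2C
    obtain ⟨hgflat, hgpos, hgtop⟩ := hGk
    have hW : 0 < sliceSq C F (Fin.tail p.1) ∧ sliceSq C F (Fin.tail p.1) < ⊤ := by
      by_contra hcon
      exact hpD ⟨hp1C, hcon⟩
    have hft := flatness_transfer hCm hSm hSC hV0 hVtop (measurable_slice hFm _)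
      (measurable_slice hΦm _) (fun x => hF0 _) (fun x => hΦ0 _) hε.le hε1
      (by positivity : (0 : ℝ) ≤ c / 32) hεκ hvol hfS hgS hpair hgflat hgpos hgtop hW.1 hW.2
    have hIp : I p.1 = h (Fin.tail p.1) :=
      Set.indicator_of_mem (show p.1 ∈ {X : Config (m + 1) | X 0 ∈ C} from hp1C) _
    rw [hIp]
    exact hft
  -- integrate
  calc ENNReal.ofReal (Real.exp (-2 * M) * (1 - ε) * (Real.sqrt (c / 32) - ε) ^ 2 * (c / 64))
      = ENNReal.ofReal (Real.exp (-2 * M) * (1 - ε) * (Real.sqrt (c / 32) - ε) ^ 2) *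
          ENNReal.ofReal (c / 64) := ENNReal.ofReal_mul hβ0
    _ ≤ ENNReal.ofReal (Real.exp (-2 * M) * (1 - ε) * (Real.sqrt (c / 32) - ε) ^ 2) * π T := by
        gcongr
    _ = ∫⁻ p in T, ENNReal.ofReal (Real.exp (-2 * M) * (1 - ε) * (Real.sqrt (c / 32) - ε) ^ 2) ∂π :=
        (setLIntegral_const T _).symm
    _ ≤ ∫⁻ p in T, I p.1 ∂π := setLIntegral_mono' hTm hptT
    _ ≤ ∫⁻ p, I p.1 ∂π := setLIntegral_le_lintegral T _

/-- **The fixed-`N` estimate.** At one `N = m+1` and one side `L`: the `A`-instance, finiteness of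
`E₀^D` (existence of the nonnegative Dirichlet ground state), a torus interface `Φ` and a coupling with
the good event of
`CoupledRelocationBound` give a macroscopic inner-cube flat-mode occupation of the Dirichlet ground
state. -/
theorem innerMode_occupation_ge {v : ℝ → ℝ≥0∞} {L : ℝ} (hL : 0 < L)
    {c ε M : ℝ} (hc : 0 < c) (hc1 : c ≤ 1) (hε : 0 < ε) (hε1 : ε < 1)
    (hεκ : ε ≤ Real.sqrt (c / 32))
    (hE0 : groundStateEnergy v (m + 1) L ≠ ⊤) {Φ : Config (m + 1) → ℝ}
    (hΦ : IsTorusInterface v m L Φ)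
    (hA : ∃ δ : ℝ≥0∞, 0 < δ ∧ ∀ Ψ : PeriodicTrialState (m + 1) L,
        periodicEnergy v Ψ ≤ periodicGroundStateEnergy v (m + 1) L + δ →
          ENNReal.ofReal (c * (m + 1 : ℕ)) ≤ condensateOccupation (m + 1) L Ψ.ψ)
    {π : Measure (Config (m + 1) × Config (m + 1))}
    (hπ1 : π.map Prod.fst = boxLaw v m L) (hπ2 : π.map Prod.snd = torusLaw m L Φ)
    {G : Set (Config (m + 1) × Config (m + 1))} (hGm : MeasurableSet G)
    (hπG : ENNReal.ofReal (1 - c / 64) ≤ π G)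
    (hGood : ∀ p ∈ G, GoodPair L (groundState v (m + 1) L) Φ ε M p) :
    ENNReal.ofReal (Real.exp (-2 * M) * (1 - ε) * (Real.sqrt (c / 32) - ε) ^ 2 * (c / 64) *
        (m + 1 : ℕ)) ≤
      occupation (m + 1) (innerMode L) (fun X => (groundState v (m + 1) L X : ℂ)) := by
  obtain ⟨hΦc, hper, hrig, hΦ0, hΦ1, happrox⟩ := hΦ
  have hΦ1' : ∫⁻ X in cellN (m + 1) L, ENNReal.ofReal (Φ X ^ 2) = 1 := by
    rw [← hΦ1]; exact lintegral_congr fun X => (ennnorm_sq_coe_real (Φ X)).symm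
  -- `A` ⟹ the inner-cube floor of the interface (landed stub G3 of line torus-in-the-box)
  have hfloor := TorusInTheBox.stub_torusFloorFromA v m L hL c hc hA Φ
    ⟨hΦc, hper, hrig, hΦ0, hΦ1, happrox⟩ (fun _ => L / 4) (fun t => ⟨by positivity, by linarith⟩)
  exact innerMode_occupation_ge_of_floor hL hc hc1 hε hε1 hεκ hE0 hΦc hΦ0 hΦ1' hfloor hπ1 hπ2 hGm
    hπG hGood

/-! ### Near-minimiser front-end (torus side without a ground-state object)

From the `A`-instance alone: a periodic near-minimiser at any prescribed slack whose MODULUS has a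
macroscopic inner-cube flat occupation — sub-cube pigeonhole `n₀ ≤ Σ_q n_{Q_q}`, rigid translation of
all bosons (`PeriodicTrialState.exists_translate`, `periodicEnergy_translate`) moving the best sub-cube
onto the inner cube, and `|∫_C Ψ| ≤ ∫_C |Ψ|`. -/

/-- For `L > 0` the periodic trial class is inhabited (the constant state). -/
theorem nonempty_periodicTrialState (N : ℕ) {L : ℝ} (hL : 0 < L) :
    Nonempty (PeriodicTrialState N L) := by
  -- adapted from `BECThomsonPrinciplePeriodicToDirichletTorusFloorFromA.nonempty_periodicTrialState`
  have hL3 : 0 < L ^ 3 := by positivity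
  have hc : ((‖(((Real.sqrt (L ^ 3))⁻¹ ^ N : ℝ) : ℂ)‖₊ : ℝ≥0∞) ^ 2) =
      ENNReal.ofReal (((L ^ 3)⁻¹) ^ N) := by
    rw [← ENNReal.coe_pow, ENNReal.ofReal, ENNReal.coe_inj]
    ext
    rw [NNReal.coe_pow, coe_nnnorm, Complex.norm_real, Real.norm_of_nonneg (by positivity),
      ← pow_mul, mul_comm, pow_mul, inv_pow, Real.sq_sqrt hL3.le,
      Real.coe_toNNReal _ (by positivity)]
  exact ⟨{ ψ := fun _ => (((Real.sqrt (L ^ 3))⁻¹ ^ N : ℝ) : ℂ)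
           contDiff := contDiff_const
           periodic := fun _ _ _ => rfl
           symm := fun _ _ => rfl
           norm_eq := by
             rw [setLIntegral_const, volume_cellN, hc, ← ENNReal.ofReal_pow hL.le,
               ← ENNReal.ofReal_pow (by positivity), ← ENNReal.ofReal_mul (by positivity),
               ← mul_pow, inv_mul_cancel₀ hL3.ne', one_pow, ENNReal.ofReal_one] }⟩

/-- Periodic near-minimisers exist at every positive slack (`L > 0`). -/
theorem exists_periodic_nearMinimiser (v : ℝ → ℝ≥0∞) (N : ℕ) {L : ℝ} (hL : 0 < L) {δ : ℝ≥0∞}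
    (hδ : 0 < δ) :
    ∃ Ψ : PeriodicTrialState N L, periodicEnergy v Ψ ≤ periodicGroundStateEnergy v N L + δ := by
  obtain ⟨Ψ₀⟩ := nonempty_periodicTrialState N hL
  by_cases htop : periodicGroundStateEnergy v N L = ⊤
  · exact ⟨Ψ₀, by rw [htop, top_add]; exact le_top⟩
  · obtain ⟨Ψ, hΨ⟩ := iInf_lt_iff.mp (ENNReal.lt_add_right htop hδ.ne')
    exact ⟨Ψ, hΨ.le⟩

/-- The 8 sub-cubes of side `L/2` lie in the cell. -/
theorem subCell_half_subset_cell {L : ℝ} (hL : 0 < L) (q : SubIdx 2) : subCell (L / 2) q ⊆ cell L := by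
  have h := subCell_subset_cell (half_pos hL) q
  rwa [show ((2 : ℕ) : ℝ) * (L / 2) = L by push_cast; ring] at h

/-- The 8 sub-cubes of side `L/2` cover the cell. -/
theorem iUnion_subCell_half {L : ℝ} (hL : 0 < L) : ⋃ q : SubIdx 2, subCell (L / 2) q = cell L := by
  ext x
  simp only [Set.mem_iUnion]
  constructor
  · rintro ⟨q, hq⟩
    exact subCell_half_subset_cell hL q hq
  · intro hx
    rw [← show ((2 : ℕ) : ℝ) * (L / 2) = L by push_cast; ring] at hx
    exact exists_mem_subCell (half_pos hL) hx

/-- Distinct sub-cubes are disjoint. -/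
theorem pairwise_disjoint_subCell_half {L : ℝ} (hs : 0 < L / 2) :
    Pairwise (Function.onFun Disjoint fun q : SubIdx 2 => subCell (L / 2) q) := fun _ _ hqq' =>
  Set.disjoint_left.mpr fun _ hx => not_mem_subCell_of_ne hs hqq' hx

/-- The cell integral of a slice splits over the 8 sub-cubes. -/
theorem setIntegral_cell_eq_sum_subCell {L : ℝ} (hL : 0 < L) {F : Config (m + 1) → ℂ}
    (hF : Continuous F) (Y : Config m) :
    ∫ x in cell L, F (Matrix.vecCons x Y) =
      ∑ q : SubIdx 2, ∫ x in subCell (L / 2) q, F (Matrix.vecCons x Y) := by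
  rw [← iUnion_subCell_half hL]
  exact integral_iUnion_fintype (fun q => measurableSet_subCell _ q)
    (pairwise_disjoint_subCell_half (half_pos hL)) fun q =>
      (integrableOn_cell (hF.comp (continuous_id.matrixVecCons continuous_const))).mono_set
        (subCell_half_subset_cell hL q)

/-- `‖Σᵢ aᵢ‖² ≤ #s · Σᵢ ‖aᵢ‖²` in `ℝ≥0∞`. -/
theorem ennnorm_sum_sq_le' {ι : Type*} (s : Finset ι) (a : ι → ℂ) :
    (‖∑ i ∈ s, a i‖₊ : ℝ≥0∞) ^ 2 ≤ (s.card : ℝ≥0∞) * ∑ i ∈ s, (‖a i‖₊ : ℝ≥0∞) ^ 2 := by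
  have h1 : ‖∑ i ∈ s, a i‖₊ ≤ ∑ i ∈ s, ‖a i‖₊ := nnnorm_sum_le s a
  have h2 : (∑ i ∈ s, ‖a i‖₊) ^ 2 ≤ s.card * ∑ i ∈ s, ‖a i‖₊ ^ 2 := sq_sum_le_card_mul_sum_sq
  have h3 : ‖∑ i ∈ s, a i‖₊ ^ 2 ≤ s.card * ∑ i ∈ s, ‖a i‖₊ ^ 2 :=
    (pow_le_pow_left' h1 2).trans h2
  have h4 : ((‖∑ i ∈ s, a i‖₊ ^ 2 : ℝ≥0) : ℝ≥0∞) ≤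
      ((s.card * ∑ i ∈ s, ‖a i‖₊ ^ 2 : ℝ≥0) : ℝ≥0∞) :=
    ENNReal.coe_le_coe.mpr h3
  push_cast at h4
  exact h4

/-- Cell occupation of a constant mode on a measurable `Q ⊆ cell` through slice integrals (any complex
constant). -/
theorem cellOccupation_indicator_const {L : ℝ} {Q : Set Space} (hQ : MeasurableSet Q)
    (hQc : Q ⊆ cell L) (c : ℂ) (F : Config (m + 1) → ℂ) :
    cellOccupation (m + 1) L (Q.indicator fun _ => c) F =
      (m + 1 : ℝ≥0∞) * ∫⁻ Y in cellN m L,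
        (‖c‖₊ : ℝ≥0∞) ^ 2 * (‖∫ x in Q, F (Matrix.vecCons x Y)‖₊ : ℝ≥0∞) ^ 2 := by
  rw [cellOccupation_succ]
  congr 1
  refine lintegral_congr fun Y => ?_
  have hind : (fun x => conj (Q.indicator (fun _ => c) x) * F (Matrix.vecCons x Y)) =
      Q.indicator fun x => conj c * F (Matrix.vecCons x Y) := by
    funext x
    by_cases hx : x ∈ Q
    · simp [hx]
    · simp [hx]
  rw [hind, integral_indicator hQ, Measure.restrict_restrict hQ, Set.inter_eq_left.mpr hQc,
    integral_const_mul, nnnorm_mul, RCLike.nnnorm_conj, ENNReal.coe_mul, mul_pow]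

/-- **Sub-cube pigeonhole**: the constant-mode occupation is at most the sum of the 8 flat sub-cube
occupations, `n₀(F) ≤ Σ_q n_{Q_q}(F)`, for a continuous `F`. -/
theorem condensateOccupation_le_sum_subCell {L : ℝ} (hL : 0 < L) {F : Config (m + 1) → ℂ}
    (hF : Continuous F) :
    condensateOccupation (m + 1) L F ≤
      ∑ q : SubIdx 2, cellOccupation (m + 1) L
        ((subCell (L / 2) q).indicator fun _ => ((Real.sqrt ((L / 2) ^ 3))⁻¹ : ℂ)) F := by
  set c₀ : ℂ := ((Real.sqrt (L ^ 3))⁻¹ : ℂ) with hc₀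
  set c₁ : ℂ := ((Real.sqrt ((L / 2) ^ 3))⁻¹ : ℂ) with hc₁
  have hn₀ : ((‖c₀‖₊ : ℝ≥0∞)) ^ 2 = ENNReal.ofReal (L ^ 3)⁻¹ := ennnorm_inv_sqrt_sq' (by positivity)
  have hn₁ : ((‖c₁‖₊ : ℝ≥0∞)) ^ 2 = 8 * ((‖c₀‖₊ : ℝ≥0∞)) ^ 2 := by
    have h : ((L / 2) ^ 3)⁻¹ = 8 * (L ^ 3)⁻¹ := by
      rw [div_pow, inv_div, div_eq_mul_inv]; norm_num
    rw [hn₀, hc₁, ennnorm_inv_sqrt_sq' (by positivity), h, ENNReal.ofReal_mul (by norm_num),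
      ENNReal.ofReal_ofNat]
  have hLHS : condensateOccupation (m + 1) L F = cellOccupation (m + 1) L (fun _ => c₀) F := rfl
  have hcard : ((Finset.univ : Finset (SubIdx 2)).card : ℝ≥0∞) = 8 := by
    rw [Finset.card_univ, Fintype.card_fun, Fintype.card_fin, Fintype.card_fin]
    norm_num
  have hmeas : ∀ q : SubIdx 2, Measurable fun Y : Config m =>
      (‖∫ x in subCell (L / 2) q, F (Matrix.vecCons x Y)‖₊ : ℝ≥0∞) ^ 2 :=
    fun q => measurable_sliceSetIntegral_sq hF _
  rw [hLHS, cellOccupation_succ]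
  have hRHS : ∑ q : SubIdx 2, cellOccupation (m + 1) L
      ((subCell (L / 2) q).indicator fun _ => c₁) F =
      (m + 1 : ℝ≥0∞) * ∑ q : SubIdx 2, ∫⁻ Y in cellN m L,
        ((‖c₁‖₊ : ℝ≥0∞)) ^ 2 * (‖∫ x in subCell (L / 2) q, F (Matrix.vecCons x Y)‖₊ : ℝ≥0∞) ^ 2 := by
    rw [Finset.mul_sum]
    exact Finset.sum_congr rfl fun q _ =>
      cellOccupation_indicator_const (measurableSet_subCell _ _) (subCell_half_subset_cell hL q) c₁ F
  rw [hRHS]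
  gcongr
  rw [← lintegral_finsetSum _ fun q _ => (hmeas q).const_mul _]
  refine lintegral_mono fun Y => ?_
  calc (‖∫ x in cell L, conj c₀ * F (Matrix.vecCons x Y)‖₊ : ℝ≥0∞) ^ 2
      = ((‖c₀‖₊ : ℝ≥0∞)) ^ 2 *
          (‖∑ q : SubIdx 2, ∫ x in subCell (L / 2) q, F (Matrix.vecCons x Y)‖₊ : ℝ≥0∞) ^ 2 := by
        rw [integral_const_mul, setIntegral_cell_eq_sum_subCell hL hF Y, nnnorm_mul,
          RCLike.nnnorm_conj, ENNReal.coe_mul, mul_pow]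
    _ ≤ ((‖c₀‖₊ : ℝ≥0∞)) ^ 2 * (8 *
          ∑ q : SubIdx 2, (‖∫ x in subCell (L / 2) q, F (Matrix.vecCons x Y)‖₊ : ℝ≥0∞) ^ 2) := by
        gcongr
        have h := ennnorm_sum_sq_le' Finset.univ
          (fun q : SubIdx 2 => ∫ x in subCell (L / 2) q, F (Matrix.vecCons x Y))
        rwa [hcard] at h
    _ = ∑ q : SubIdx 2,
          ((‖c₁‖₊ : ℝ≥0∞)) ^ 2 * (‖∫ x in subCell (L / 2) q, F (Matrix.vecCons x Y)‖₊ : ℝ≥0∞) ^ 2 := by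
        rw [hn₁, Finset.mul_sum, Finset.mul_sum]
        refine Finset.sum_congr rfl fun q _ => ?_
        ring

/-- Modulus only increases the occupation of a constant mode on `Q`: `|∫_Q c̄F| ≤ ∫_Q |c||F|`. -/
theorem cellOccupation_indicator_le_norm {L : ℝ} {Q : Set Space} (hQ : MeasurableSet Q)
    (hQc : Q ⊆ cell L) (c : ℂ) (F : Config (m + 1) → ℂ) :
    cellOccupation (m + 1) L (Q.indicator fun _ => c) F ≤
      cellOccupation (m + 1) L (Q.indicator fun _ => c) fun X => ((‖F X‖ : ℝ) : ℂ) := by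
  rw [cellOccupation_indicator_const hQ hQc, cellOccupation_indicator_const hQ hQc]
  gcongr with Y
  -- `‖∫_Q F‖ ≤ ∫_Q ‖F‖ = ‖∫_Q (‖F‖ : ℂ)‖`
  have h1 : ‖∫ x in Q, F (Matrix.vecCons x Y)‖ ≤ ∫ x in Q, ‖F (Matrix.vecCons x Y)‖ :=
    norm_integral_le_integral_norm _
  have h2 : ∫ x in Q, (((‖F (Matrix.vecCons x Y)‖ : ℝ) : ℂ)) =
      ((∫ x in Q, ‖F (Matrix.vecCons x Y)‖ : ℝ) : ℂ) := integral_complex_ofReal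
  have h3 : ‖∫ x in Q, (((‖F (Matrix.vecCons x Y)‖ : ℝ) : ℂ))‖ = ∫ x in Q, ‖F (Matrix.vecCons x Y)‖ := by
    rw [h2, Complex.norm_real, Real.norm_of_nonneg (integral_nonneg fun x => norm_nonneg _)]
  have h4 : ‖∫ x in Q, F (Matrix.vecCons x Y)‖ ≤ ‖∫ x in Q, (((‖F (Matrix.vecCons x Y)‖ : ℝ) : ℂ))‖ := by
    rw [h3]; exact h1
  exact NNReal.coe_le_coe.1 (by rw [coe_nnnorm, coe_nnnorm]; exact h4)

/-- `(x :: Y) - (t, …, t) = (x - t) :: (Y - (t, …, t))`. -/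
theorem vecCons_sub_const (x : Space) (Y : Config m) (t : Space) :
    (Matrix.vecCons x Y : Config (m + 1)) - (fun _ => t) = Matrix.vecCons (x - t) (Y - fun _ => t) := by
  funext i
  refine Fin.cases ?_ (fun k => ?_) i
  · simp
  · simp

/-- `x :: (Y + e_k ⊗ u) = (x :: Y) + e_{k+1} ⊗ u`. -/
theorem vecCons_add_single_succ (x : Space) (Y : Config m) (k : Fin m) (u : Space) :
    (Matrix.vecCons x (Y + Pi.single k u) : Config (m + 1)) =
      Matrix.vecCons x Y + Pi.single k.succ u := by
  funext i
  refine Fin.cases ?_ (fun k' => ?_) i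
  · simp [Ne.symm (Fin.succ_ne_zero k)]
  · by_cases h : k' = k
    · subst h; simp
    · simp [h, Fin.succ_inj]

/-- **Translation moves a sub-cube onto the inner cube**: if `Ψ = Φ(· - (t,…,t))` with
`t = (L/4, L/4, L/4) - ℓq` then the inner-cube flat occupation of `Ψ` is the `q`-th sub-cube flat
occupation of `Φ` (Lebesgue translation in `x`, lattice periodicity in the spectators). -/
theorem cellOccupation_innerMode_translate {L : ℝ} (hL : 0 < L) (Φ Ψ : PeriodicTrialState (m + 1) L)
    (q : SubIdx 2)
    (hΨ : Ψ.ψ = fun X => Φ.ψ (X - fun _ => (WithLp.toLp 2 fun _ : Fin 3 => L / 4) - subOffset (L / 2) q)) :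
    cellOccupation (m + 1) L (innerMode L) Ψ.ψ =
      cellOccupation (m + 1) L
        ((subCell (L / 2) q).indicator fun _ => ((Real.sqrt ((L / 2) ^ 3))⁻¹ : ℂ)) Φ.ψ := by
  set b : Space := WithLp.toLp 2 fun _ : Fin 3 => L / 4 with hb
  set a : Space := subOffset (L / 2) q with ha
  set t : Space := b - a with ht
  have hCeq : innerCube L = cellShift (L / 2) b := innerCube_eq_cellShift L
  have hQeq : subCell (L / 2) q = cellShift (L / 2) a := rfl
  rw [innerMode, hCeq, cellOccupation_indicator_const (measurableSet_cellShift _ _)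
      (hCeq ▸ innerCube_subset_cell L),
    cellOccupation_indicator_const (measurableSet_subCell _ _) (subCell_half_subset_cell hL q)]
  congr 1
  -- the `x`-integral: `∫_{b + cell} Ψ(x, Y) = ∫_{a + cell} Φ(x, Y - t𝟙)`
  have hx : ∀ Y : Config m, ∫ x in cellShift (L / 2) b, Ψ.ψ (Matrix.vecCons x Y) =
      ∫ x in subCell (L / 2) q, Φ.ψ (Matrix.vecCons x (Y - fun _ => t)) := by
    intro Y
    rw [hQeq, ← setIntegral_cell_comp_add (L / 2) _ b, ← setIntegral_cell_comp_add (L / 2) _ a]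
    refine integral_congr_ae (Eventually.of_forall fun x => ?_)
    show Ψ.ψ (Matrix.vecCons (x + b) Y) = Φ.ψ (Matrix.vecCons (x + a) (Y - fun _ => t))
    rw [hΨ]
    show Φ.ψ (Matrix.vecCons (x + b) Y - fun _ => t) = _
    rw [vecCons_sub_const]
    congr 2
    rw [ht]; abel
  simp_rw [hx]
  -- the `Y`-integral: lattice periodicity of the slice integrals
  have hper : ∀ (Y : Config m) (k : Fin m) (c : Fin 3),
      (‖∫ x in subCell (L / 2) q, Φ.ψ (Matrix.vecCons x
          (Y + Pi.single k (EuclideanSpace.single c L)))‖₊ : ℝ≥0∞) ^ 2 =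
        (‖∫ x in subCell (L / 2) q, Φ.ψ (Matrix.vecCons x Y)‖₊ : ℝ≥0∞) ^ 2 := by
    intro Y k c
    congr 3
    refine integral_congr_ae (Eventually.of_forall fun x => ?_)
    show Φ.ψ (Matrix.vecCons x (Y + Pi.single k (EuclideanSpace.single c L))) = Φ.ψ (Matrix.vecCons x Y)
    rw [vecCons_add_single_succ, Φ.periodic]
  have h := lintegral_cellN_comp_add hL
    (G := fun Y : Config m => ((‖((Real.sqrt ((L / 2) ^ 3))⁻¹ : ℂ)‖₊ : ℝ≥0∞)) ^ 2 *
      (‖∫ x in subCell (L / 2) q, Φ.ψ (Matrix.vecCons x Y)‖₊ : ℝ≥0∞) ^ 2)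
    (fun Y k c => by simp only [hper]) (-fun _ => t)
  simp only [← sub_eq_add_neg] at h
  exact h

/-- **The near-minimiser front-end.** From the `A`-instance (constant `c`) and any slack `δR > 0`: a
periodic near-minimiser `Ψ` at slack `δR` whose modulus occupies the inner-cube flat mode by
`≥ (c/16)(m+1)`. -/
theorem exists_nearMinimiser_innerMode_floor {v : ℝ → ℝ≥0∞} {L : ℝ} (hL : 0 < L) {c : ℝ} (hc : 0 < c)
    {δR : ℝ≥0∞} (hδR : 0 < δR)
    (hA : ∃ δ : ℝ≥0∞, 0 < δ ∧ ∀ Φ : PeriodicTrialState (m + 1) L,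
        periodicEnergy v Φ ≤ periodicGroundStateEnergy v (m + 1) L + δ →
          ENNReal.ofReal (c * (m + 1 : ℕ)) ≤ condensateOccupation (m + 1) L Φ.ψ) :
    ∃ Ψ : PeriodicTrialState (m + 1) L,
      periodicEnergy v Ψ ≤ periodicGroundStateEnergy v (m + 1) L + δR ∧
        ENNReal.ofReal (c / 16 * (m + 1 : ℕ)) ≤
          cellOccupation (m + 1) L (innerMode L) fun X => ((‖Ψ.ψ X‖ : ℝ) : ℂ) := by
  obtain ⟨δA, hδA, hAδ⟩ := hA
  obtain ⟨Φ, hΦ⟩ := exists_periodic_nearMinimiser v (m + 1) hL (lt_min hδA hδR)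
  have hocc := hAδ Φ (hΦ.trans (add_le_add_right (min_le_left _ _) _))
  -- pigeonhole: some sub-cube carries `≥ n₀/8`
  set n : SubIdx 2 → ℝ≥0∞ := fun q => cellOccupation (m + 1) L
    ((subCell (L / 2) q).indicator fun _ => ((Real.sqrt ((L / 2) ^ 3))⁻¹ : ℂ)) Φ.ψ with hn
  have hsum : ENNReal.ofReal (c * (m + 1 : ℕ)) ≤ ∑ q : SubIdx 2, n q :=
    hocc.trans (condensateOccupation_le_sum_subCell hL Φ.contDiff.continuous)
  obtain ⟨q, -, hq⟩ := Finset.exists_max_image Finset.univ n ⟨fun _ => 0, Finset.mem_univ _⟩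
  have hcard : (Finset.univ : Finset (SubIdx 2)).card = 8 := by
    rw [Finset.card_univ, Fintype.card_fun, Fintype.card_fin, Fintype.card_fin]; norm_num
  have hmax : ∑ q' : SubIdx 2, n q' ≤ 8 * n q := by
    calc ∑ q' : SubIdx 2, n q' ≤ ∑ _q' : SubIdx 2, n q := Finset.sum_le_sum fun q' _ => hq q' (Finset.mem_univ _)
      _ = 8 * n q := by rw [Finset.sum_const, hcard]; simp
  -- translate the best sub-cube onto the inner cube
  set t : Space := (WithLp.toLp 2 fun _ : Fin 3 => L / 4) - subOffset (L / 2) q with ht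
  obtain ⟨Ψ, hΨ⟩ := Φ.exists_translate t
  refine ⟨Ψ, ?_, ?_⟩
  · rw [periodicEnergy_translate v Φ t hΨ]
    exact hΦ.trans (add_le_add_right (min_le_right _ _) _)
  · have htr := cellOccupation_innerMode_translate hL Φ Ψ q hΨ
    have hmod := cellOccupation_indicator_le_norm (m := m) (measurableSet_innerCube L)
      (innerCube_subset_cell L) ((Real.sqrt ((L / 2) ^ 3))⁻¹ : ℂ) Ψ.ψ
    have h8 : ENNReal.ofReal (c * (m + 1 : ℕ)) ≤ 8 * cellOccupation (m + 1) L (innerMode L) Ψ.ψ := by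
      rw [htr]; exact hsum.trans hmax
    have h16 : ENNReal.ofReal (c / 16 * (m + 1 : ℕ)) ≤ ENNReal.ofReal (c / 8 * (m + 1 : ℕ)) :=
      ENNReal.ofReal_le_ofReal (by gcongr; norm_num)
    refine h16.trans ?_
    have h8' : ENNReal.ofReal (c * (m + 1 : ℕ)) = 8 * ENNReal.ofReal (c / 8 * (m + 1 : ℕ)) := by
      rw [← ENNReal.ofReal_ofNat 8, ← ENNReal.ofReal_mul (by norm_num)]
      congr 1; ring
    rw [h8'] at h8
    exact ((ENNReal.mul_le_mul_iff_right (by norm_num) ENNReal.ofNat_ne_top).mp h8).trans hmod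

/-- **`BoundaryTransferWeak` from three pieces, near-minimiser typing** (no torus ground-state object;
the hypothesis `A` enters through `exists_nearMinimiser_innerMode_floor`). -/
theorem boundaryTransferWeak_of_coupledBathsNearMin (hC : CoupledRelocationBoundNearMin)
    (hR : BECWallDressingTransfer.GroundStateRigidity) (hB : InnerFlatGroundStateToBEC) :
    BECSectorPoincareTwoScale.BoundaryTransferWeak := by
  intro v hv hA
  obtain ⟨ρA, hρA, HA⟩ := hA
  obtain ⟨ρC, hρC, HC⟩ := hC v hv
  obtain ⟨ρB, hρB, HB⟩ := hB v hv (hR v hv)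
  obtain ⟨ρX, hρX, HX⟩ := Theorems.BECInsertionVariance.eventually_groundStateEnergy_ne_top hv
  refine ⟨min (min ρA ρC) (min ρB ρX), lt_min (lt_min hρA hρC) (lt_min hρB hρX), fun ρ hρ hlt => ?_⟩
  have hρA' : ρ < ρA := hlt.trans_le ((min_le_left _ _).trans (min_le_left _ _))
  have hρC' : ρ < ρC := hlt.trans_le ((min_le_left _ _).trans (min_le_right _ _))
  have hρB' : ρ < ρB := hlt.trans_le ((min_le_right _ _).trans (min_le_left _ _))
  have hρX' : ρ < ρX := hlt.trans_le ((min_le_right _ _).trans (min_le_right _ _))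
  obtain ⟨c, hc, hAN⟩ := HA ρ hρ hρA'
  -- constants (all fixed before `N`)
  set c₀ : ℝ := min c 1 with hc₀def
  have hc₀ : 0 < c₀ := lt_min hc one_pos
  have hc₀1 : c₀ ≤ 1 := min_le_right _ _
  have hc₀c : c₀ ≤ c := min_le_left _ _
  have hsq : 0 < Real.sqrt (c₀ / 32) := Real.sqrt_pos.2 (by positivity)
  set ε : ℝ := min (1 / 2) (Real.sqrt (c₀ / 32) / 2) with hεdef
  have hε : 0 < ε := lt_min (by norm_num) (by positivity)
  have hε1 : ε < 1 := (min_le_left _ _).trans_lt (by norm_num)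
  have hεκ : ε ≤ Real.sqrt (c₀ / 32) := (min_le_right _ _).trans (by linarith)
  obtain ⟨M, HM⟩ := HC ρ hρ hρC' ε hε (c₀ / 64) (by positivity)
  have hβ : 0 < Real.exp (-2 * M) * (1 - ε) * (Real.sqrt (c₀ / 32) - ε) ^ 2 * (c₀ / 64) := by
    have h1 : 0 < 1 - ε := by linarith
    have h2 : 0 < (Real.sqrt (c₀ / 32) - ε) ^ 2 := by
      have : 0 < Real.sqrt (c₀ / 32) - ε := by
        have := min_le_right (1 / 2 : ℝ) (Real.sqrt (c₀ / 32) / 2); linarith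
      positivity
    positivity
  refine HB ρ hρ hρB' _ hβ ?_
  have hAm : ∀ᶠ m : ℕ in atTop, ∃ δ : ℝ≥0∞, 0 < δ ∧
      ∀ Ψ : PeriodicTrialState (m + 1) (sideLength ρ (m + 1)),
        periodicEnergy v Ψ ≤ periodicGroundStateEnergy v (m + 1) (sideLength ρ (m + 1)) + δ →
          ENNReal.ofReal (c * ((m + 1 : ℕ) : ℝ)) ≤
            condensateOccupation (m + 1) (sideLength ρ (m + 1)) Ψ.ψ :=
    (tendsto_add_atTop_nat 1).eventually hAN
  have hXm : ∀ᶠ m : ℕ in atTop, groundStateEnergy v (m + 1) (sideLength ρ (m + 1)) ≠ ⊤ :=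
    (tendsto_add_atTop_nat 1).eventually (HX ρ hρ hρX')
  filter_upwards [HM, hAm, hXm] with m hMm hAm' hE0
  obtain ⟨δR, hδR, HR⟩ := hMm hE0
  refine ⟨hE0, ?_⟩
  have hL : 0 < sideLength ρ (m + 1) := by
    unfold sideLength
    exact Real.rpow_pos_of_pos (div_pos (by exact_mod_cast Nat.succ_pos m) hρ) _
  -- weaken the constant of `A` to `c₀ ≤ 1`
  have hA₀ : ∃ δ : ℝ≥0∞, 0 < δ ∧ ∀ Ψ : PeriodicTrialState (m + 1) (sideLength ρ (m + 1)),
      periodicEnergy v Ψ ≤ periodicGroundStateEnergy v (m + 1) (sideLength ρ (m + 1)) + δ →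
        ENNReal.ofReal (c₀ * (m + 1 : ℕ)) ≤
          condensateOccupation (m + 1) (sideLength ρ (m + 1)) Ψ.ψ := by
    obtain ⟨δ, hδ, h⟩ := hAm'
    exact ⟨δ, hδ, fun Ψ hΨ => (ENNReal.ofReal_le_ofReal
      (mul_le_mul_of_nonneg_right hc₀c (Nat.cast_nonneg _))).trans (h Ψ hΨ)⟩
  -- the near-minimiser with inner-cube floor, then the coupling for it
  obtain ⟨Ψ, hΨE, hfloor⟩ := exists_nearMinimiser_innerMode_floor hL hc₀ hδR hA₀
  obtain ⟨π, hπ1, hπ2, G, hGm, hπG, hGood⟩ := HR Ψ hΨE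
  have hΦc : Continuous fun X => ‖Ψ.ψ X‖ := continuous_norm.comp Ψ.contDiff.continuous
  have hΦ0 : ∀ X, 0 ≤ ‖Ψ.ψ X‖ := fun X => norm_nonneg _
  have hΦ1' : ∫⁻ X in cellN (m + 1) (sideLength ρ (m + 1)), ENNReal.ofReal (‖Ψ.ψ X‖ ^ 2) = 1 := by
    rw [← Ψ.norm_eq]
    exact lintegral_congr fun X => (coe_nnnorm_sq_eq_ofReal (Ψ.ψ X)).symm
  exact innerMode_occupation_ge_of_floor hL hc₀ hc₀1 hε hε1 hεκ hE0 hΦc hΦ0 hΦ1' hfloor hπ1 hπ2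
    hGm hπG hGood

/-- **`BoundaryTransferWeak` from the four pieces** (the hypothesis `A` enters through
`TorusInTheBox.stub_torusFloorFromA` inside `innerMode_occupation_ge`). -/
theorem boundaryTransferWeak_of_coupledBaths (hE : TorusInterfaceExists)
    (hC : CoupledRelocationBound) (hR : BECWallDressingTransfer.GroundStateRigidity)
    (hB : InnerFlatGroundStateToBEC) : BECSectorPoincareTwoScale.BoundaryTransferWeak := by
  intro v hv hA
  obtain ⟨ρA, hρA, HA⟩ := hA
  obtain ⟨ρE, hρE, HE⟩ := hE v hv
  obtain ⟨ρC, hρC, HC⟩ := hC v hv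
  obtain ⟨ρB, hρB, HB⟩ := hB v hv (hR v hv)
  obtain ⟨ρX, hρX, HX⟩ := Theorems.BECInsertionVariance.eventually_groundStateEnergy_ne_top hv
  refine ⟨min (min ρA ρE) (min ρC (min ρB ρX)),
    lt_min (lt_min hρA hρE) (lt_min hρC (lt_min hρB hρX)), fun ρ hρ hlt => ?_⟩
  have hρA' : ρ < ρA := hlt.trans_le ((min_le_left _ _).trans (min_le_left _ _))
  have hρE' : ρ < ρE := hlt.trans_le ((min_le_left _ _).trans (min_le_right _ _))
  have hρC' : ρ < ρC := hlt.trans_le ((min_le_right _ _).trans (min_le_left _ _))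
  have hρB' : ρ < ρB :=
    hlt.trans_le ((min_le_right _ _).trans ((min_le_right _ _).trans (min_le_left _ _)))
  have hρX' : ρ < ρX :=
    hlt.trans_le ((min_le_right _ _).trans ((min_le_right _ _).trans (min_le_right _ _)))
  obtain ⟨c, hc, hAN⟩ := HA ρ hρ hρA'
  -- constants (all fixed before `N`)
  set c₀ : ℝ := min c 1 with hc₀def
  have hc₀ : 0 < c₀ := lt_min hc one_pos
  have hc₀1 : c₀ ≤ 1 := min_le_right _ _
  have hc₀c : c₀ ≤ c := min_le_left _ _
  have hsq : 0 < Real.sqrt (c₀ / 32) := Real.sqrt_pos.2 (by positivity)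
  set ε : ℝ := min (1 / 2) (Real.sqrt (c₀ / 32) / 2) with hεdef
  have hε : 0 < ε := lt_min (by norm_num) (by positivity)
  have hε1 : ε < 1 := (min_le_left _ _).trans_lt (by norm_num)
  have hεκ : ε ≤ Real.sqrt (c₀ / 32) := (min_le_right _ _).trans (by linarith)
  have hεκ' : Real.sqrt (c₀ / 32) / 2 ≤ Real.sqrt (c₀ / 32) - ε := by
    have := min_le_right (1 / 2 : ℝ) (Real.sqrt (c₀ / 32) / 2)
    linarith
  obtain ⟨M, HM⟩ := HC ρ hρ hρC' ε hε (c₀ / 64) (by positivity)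
  have hβ : 0 < Real.exp (-2 * M) * (1 - ε) * (Real.sqrt (c₀ / 32) - ε) ^ 2 * (c₀ / 64) := by
    have h1 : 0 < 1 - ε := by linarith
    have h2 : 0 < (Real.sqrt (c₀ / 32) - ε) ^ 2 := by
      have : 0 < Real.sqrt (c₀ / 32) - ε := by linarith
      positivity
    positivity
  refine HB ρ hρ hρB' _ hβ ?_
  -- the `A`-instance along `N = m + 1`
  have hAm : ∀ᶠ m : ℕ in atTop, ∃ δ : ℝ≥0∞, 0 < δ ∧
      ∀ Ψ : PeriodicTrialState (m + 1) (sideLength ρ (m + 1)),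
        periodicEnergy v Ψ ≤ periodicGroundStateEnergy v (m + 1) (sideLength ρ (m + 1)) + δ →
          ENNReal.ofReal (c * ((m + 1 : ℕ) : ℝ)) ≤
            condensateOccupation (m + 1) (sideLength ρ (m + 1)) Ψ.ψ :=
    (tendsto_add_atTop_nat 1).eventually hAN
  have hXm : ∀ᶠ m : ℕ in atTop, groundStateEnergy v (m + 1) (sideLength ρ (m + 1)) ≠ ⊤ :=
    (tendsto_add_atTop_nat 1).eventually (HX ρ hρ hρX')
  filter_upwards [HE ρ hρ hρE', HM, hAm, hXm] with m hEm hMm hAm' hE0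
  obtain ⟨Φ, hΦ⟩ := hEm
  obtain ⟨π, hπ1, hπ2, G, hGm, hπG, hGood⟩ := hMm hE0 Φ hΦ
  refine ⟨hE0, ?_⟩
  have hL : 0 < sideLength ρ (m + 1) := by
    unfold sideLength
    exact Real.rpow_pos_of_pos (div_pos (by exact_mod_cast Nat.succ_pos m) hρ) _
  -- weaken the constant of `A` to `c₀ ≤ 1`
  have hA₀ : ∃ δ : ℝ≥0∞, 0 < δ ∧ ∀ Ψ : PeriodicTrialState (m + 1) (sideLength ρ (m + 1)),
      periodicEnergy v Ψ ≤ periodicGroundStateEnergy v (m + 1) (sideLength ρ (m + 1)) + δ →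
        ENNReal.ofReal (c₀ * (m + 1 : ℕ)) ≤
          condensateOccupation (m + 1) (sideLength ρ (m + 1)) Ψ.ψ := by
    obtain ⟨δ, hδ, h⟩ := hAm'
    exact ⟨δ, hδ, fun Ψ hΨ => (ENNReal.ofReal_le_ofReal
      (mul_le_mul_of_nonneg_right hc₀c (Nat.cast_nonneg _))).trans (h Ψ hΨ)⟩
  exact innerMode_occupation_ge hL hc₀ hc₀1 hε hε1 hεκ hE0 hΦ hA₀ hπ1 hπ2 hGm hπG hGood

end Assembly

/-! ## Registered stubs of the line `coupled_baths_certified` and the composition BY NAME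

Everything above is PROVED. Along the near-minimiser typing the crux is exactly THREE statements:
the research stub `CoupledRelocationBoundNearMin`, the pooled stmt-9072, and the per-potential box
closing (provable now). (The interface-typed composition `boundaryTransferWeak_of_coupledBaths`, with the
extra existence input `TorusInterfaceExists`, is kept above as an alternative implication form.) -/

/-- **Stub R** (RESEARCH; idea card `coupled-bath-relocation`, the live lead's typing): the coupled
relocation bound for torus near-minimisers. -/
theorem stub_coupledRelocationBoundNearMin : CoupledRelocationBoundNearMin := by
  sorry

/-- **Stub D** (pooled item stmt-AtomisticToContinuum-9072 verbatim; not worked on this line). -/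
theorem stub_rigidity : BECWallDressingTransfer.GroundStateRigidity := by
  sorry

/-- **Stub C** (support, provable now; patterns p108102 / p106607 / p107171 with
`BECInsertionVariance.isGroundState_groundState_of_ne_top`). -/
theorem stub_innerFlatGroundStateToBEC : InnerFlatGroundStateToBEC := by
  sorry

/-- **The crux BY NAME from the registered stubs** (the item's canonical decl
`BECPeriodicReduction.BoundaryTransferWeak`, definitionally every route's copy). -/
theorem boundaryTransferWeak_of_registered_stubs : BECPeriodicReduction.BoundaryTransferWeak :=
  boundaryTransferWeak_of_coupledBathsNearMin stub_coupledRelocationBoundNearMin stub_rigidity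
    stub_innerFlatGroundStateToBEC

/-- Implication form, route `BECSectorPoincareTwoScale` decl (this strategist's route). -/
theorem BoundaryTransferWeak_of :
    CoupledRelocationBoundNearMin → BECWallDressingTransfer.GroundStateRigidity →
      InnerFlatGroundStateToBEC → BECSectorPoincareTwoScale.BoundaryTransferWeak :=
  boundaryTransferWeak_of_coupledBathsNearMin

/-- Implication form for the live lead's decl (route `BECInsertionCorrector`). -/
theorem insertionCorrector_BoundaryTransferWeak_of :
    CoupledRelocationBoundNearMin → BECWallDressingTransfer.GroundStateRigidity →
      InnerFlatGroundStateToBEC → BECInsertionCorrector.BoundaryTransferWeak :=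
  boundaryTransferWeak_of_coupledBathsNearMin

/-- Interface-typed implication form for the live lead's decl. -/
theorem insertionCorrector_BoundaryTransferWeak_of_interface :
    TorusInterfaceExists → CoupledRelocationBound → BECWallDressingTransfer.GroundStateRigidity →
      InnerFlatGroundStateToBEC → BECInsertionCorrector.BoundaryTransferWeak :=
  boundaryTransferWeak_of_coupledBaths

end Summit.AtomisticToContinuum.BoseEinsteinCondensation.Cruxes.BoundaryTransferWeak.CoupledBathsCertified

end
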